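import Literature.Probability.Percolation.TriHexagon
import Literature.Probability.Percolation.SmirnovRSW
import HarnessLib

/-!
# Bollobás–Riordan's Lemma 4 in an elongated lattice hexagon of `𝕋`, at every density

Topic `Literature/Probability/Percolation`; family `crit-perc`. Second service file for the
Russo–Seymour–Welsh leaf of `Literature.Probability.Percolation.triCorrLength_exponent`
(continuation of `TriHexagon.lean`). It proves, for site percolation on `𝕋` at a general density
`p`, the analogue of Bollobás–Riordan's Lemma 4 (*Percolation*, Ch. 3; *A short proof of the
Harris–Kesten theorem*, 2006) in which the small square `S` is replaced by the lattice hexagon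
`S = H_j` (`TriHexagon.hexRegion j`, rows `0 … 2j`; unlike a lattice parallelogram it has both its
"horizontal" and "vertical" crossing probabilities controlled by rhombus crossings,
`TriHexagon.hexOpposite_prob_ge`) sitting in the bottom-left corner of the **elongated hexagon**

  `R = {0 ≤ x₁ ≤ 4j + 2, -j - 1 ≤ x₀ ≤ w, j ≤ x₀ + x₁ ≤ w + 2j + 1}`   (`bigR j w`, `w ≥ 3j + 1`),

symmetric under the reflection `ρ (x₀, x₁) = (x₀ + x₁ - (2j+1), 4j + 2 - x₁)` of `𝕋` in its
middle row (`rhoB`; `S` lies strictly below that row, `ρ S` strictly above). Between the left ends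
of `S`, `ρS` and the left end of `R` there is a **pocket** (`pocket`), which we remove:
`R° = R \ pocket` (`Rcirc`) is `ρ`-symmetric and its boundary towards the pocket is
`LE⁺ = leftEnd ∪ ρ leftEnd ∪ {gateway}` (`leftEnd = s₅ ∪ s₆` of `S`, `gateway = (0, 2j+1)`); the
**entry lemma** `mem_LEplus_of_adj_pocket` says one enters the pocket only through `LE⁺`.

**Main result** (`xev_prob_ge`): for all `p`, `j`, `w ≥ 3j + 1`,

  `P_p(X(R)) ≥ P_p(E°) · P_p(s₁ ↔ s₄ in H_j) / 2`,

where `X(R)` (`Xev`) is "a site of `S` joined inside `S` by open paths to the bottom and to the top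
side of `S`, and inside `R°` to the right end of `R`" (Bollobás–Riordan's "`P₁ ∪ P₂`, `P₁` crossing
`S` from top to bottom and `P₂` joining `P₁` to the right-hand side of `R`"), and `E°` (`Ecirc`) is
"an open path in `R°` from the right end of `R` to `LE⁺`" (their `H(R)`).

Conditioning follows the cluster formulation of `SmirnovRSW.lean` rather than left-most crossings:
`Lcl ω` is the white cluster of the left end of `S` inside `S`, `Eev L₀ = {L = L₀}`,
`Fset L₀ = L₀ ∪ ∂_S L₀ ∪ leftEnd` the frozen set. New here is the **sealed barrier**: `Reach L₀`,
the part of `S \ F` joined to the right end of `S` inside `S \ F` ("`S` to the right of `P₁`"),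
`Seal L₀ = S \ Reach L₀` (frozen set plus enclosed pockets), `AxBlock L₀`, the axis sites both of
whose lower neighbours are sealed, and `Barrier = Seal ∪ ρ Seal ∪ AxBlock`; the symmetric domain is
`Dset L₀ = R° \ Barrier` and `Yev L₀` is Bollobás–Riordan's `Y(P₁)` (an open path inside `D` from
a site adjacent to `F` to the right end of `R`), `Y'ev` its mirror image. Steps:

* `Ecirc_subset_Yev_union` — **covering** `E° ⊆ Y(L₀) ∪ Y'(L₀)` for every `L₀ ⊆ S`: the path ends
  in `LE⁺ ⊆ Barrier ∪ {gateway}`, and a first entrance into the barrier happens from a site adjacent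
  to `F` or `ρF` (`adj_Fset_or_of_adj_Barrier`, a finite case analysis using only that `Reach` is
  closed under adjacency in `S \ F`);
* `real_Y'ev` — **symmetry** `P(Y') = P(Y)`, whence `P(Y(L₀)) ≥ P(E°)/2`;
* `determinedBy_Eev`, `determinedBy_Yev`, `real_Eev_inter_Yev` — **independence** (`{L = L₀}` is
  determined by `F(L₀)`, `Y(L₀)` by `D(L₀)`, disjoint);
* `not_mem_rightEndS_of_mem_Lcl`, `hexCross_subset_iUnion_Eev` — **admissibility**: on an open
  bottom–top crossing of `S` the left-end white cluster misses the right end of `S`;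
* `real_ge_of_glue` — the conditioning sum, for any event containing all `{L = L₀} ∩ Y(L₀)`;
* `hexRegion_hex`, `hexRegion_excl` — the Hex lemma (existence, exclusivity) for the four arcs
  `s₁ | s₂ ∪ s₃ | s₄ | s₅ ∪ s₆` of the lattice hexagon, by padding the cut-off corners of `R(2j,2j)`;
* `exists_frozen_crossing` — **the frozen crossing**: `F(L₀) \ L₀` contains a bottom–top crossing of
  `S` (Bollobás–Riordan's `LV(S) = P₁`), open on `{L = L₀}`;
* `mem_of_frozen_crossing` — **frontier lemma**: a frozen site adjacent to `Reach` (or on the right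
  end of `S`) lies on every such crossing (Hex exclusivity against the unexplored path continued
  through `L₀` to the left end);
* `Eev_inter_Yev_subset_Xev` — **gluing** `{L = L₀} ∩ Y(L₀) ⊆ X(R)`, and `xev_prob_ge`.

## References

* B. Bollobás, O. Riordan, *Percolation*, CUP (2006), Ch. 3, Lemma 4 [BollobasRiordan2006].
* H. Kesten, *Percolation theory for mathematicians* (1982), Ch. 6 [KestenPTM1982].

## Mathlib / tree

Mathlib: `Equiv`. Tree: `TriHexagon.hexRegion`, `hexSide`, `triGraph_adj_iff_brick`, `brickX`
(`TriHexagon.lean`, `BrickHex.lean`), `PathIn.inter_of_forall`, `PathIn.mem_of_closed`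
(`SmirnovRSW.lean`, whose architecture — cluster conditioning, frozen set, symmetric domain,
Hex-lemma devices — this file follows).
-/

noncomputable section

open MeasureTheory

namespace Literature.Probability.Percolation

open LatticeModels

namespace TriHexagon

/-! ### The elongated hexagon, its reflection, the pocket -/

section Regions

variable (j w : ℕ)

/-- The elongated hexagon `R = {0 ≤ x₁ ≤ 4j+2, -j-1 ≤ x₀ ≤ w, j ≤ x₀ + x₁ ≤ w + 2j + 1}`: rows
`0 … 4j+2`, two `60°`-sides `x₀ = -j-1`, `x₀ = w` and two `120°`-sides `x₀ + x₁ = j`,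
`x₀ + x₁ = w + 2j + 1`. For `w = 3j + 1` it is the hexagon `H_{2j+1}` translated by `(-j-1, 0)`.
[cite: BollobasRiordan2006, Ch. 3 Lemma 4] -/
def bigR : Set (Site 2) :=
  {z | 0 ≤ z 1 ∧ z 1 ≤ 4 * j + 2 ∧ -((j : ℤ) + 1) ≤ z 0 ∧ z 0 ≤ w ∧ (j : ℤ) ≤ z 0 + z 1 ∧
    z 0 + z 1 ≤ w + 2 * j + 1}

/-- Membership in `bigR`, unfolded. [folklore] -/
theorem mem_bigR {z : Site 2} :
    z ∈ bigR j w ↔ 0 ≤ z 1 ∧ z 1 ≤ 4 * j + 2 ∧ -((j : ℤ) + 1) ≤ z 0 ∧ z 0 ≤ w ∧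
      (j : ℤ) ≤ z 0 + z 1 ∧ z 0 + z 1 ≤ w + 2 * j + 1 := Iff.rfl

/-- The right end of `R`: its two sides `x₀ = w` and `x₀ + x₁ = w + 2j + 1`. [folklore] -/
def bigRight : Set (Site 2) :=
  {z | z ∈ bigR j w ∧ (z 0 = w ∨ z 0 + z 1 = w + 2 * j + 1)}

/-- Membership in `bigRight`, unfolded. [folklore] -/
theorem mem_bigRight {z : Site 2} :
    z ∈ bigRight j w ↔ z ∈ bigR j w ∧ (z 0 = w ∨ z 0 + z 1 = w + 2 * j + 1) := Iff.rfl

/-- The **pocket**: the sites of `R` to the left of the left ends of `S` and `ρS`, i.e.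
`{j ≤ x₁ ≤ 2j+1, x₀ ≤ -1} ∪ {2j+1 ≤ x₁ ≤ 3j+2, x₀ + x₁ ≤ 2j}` (inside `R`). [folklore] -/
def pocket : Set (Site 2) :=
  {z | z ∈ bigR j w ∧ (((j : ℤ) ≤ z 1 ∧ z 1 ≤ 2 * j + 1 ∧ z 0 ≤ -1) ∨
    (2 * (j : ℤ) + 1 ≤ z 1 ∧ z 1 ≤ 3 * j + 2 ∧ z 0 + z 1 ≤ 2 * j))}

/-- Membership in the pocket, unfolded. [folklore] -/
theorem mem_pocket {z : Site 2} :
    z ∈ pocket j w ↔ z ∈ bigR j w ∧ (((j : ℤ) ≤ z 1 ∧ z 1 ≤ 2 * j + 1 ∧ z 0 ≤ -1) ∨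
      (2 * (j : ℤ) + 1 ≤ z 1 ∧ z 1 ≤ 3 * j + 2 ∧ z 0 + z 1 ≤ 2 * j)) := Iff.rfl

/-- The region `R° = R \ pocket` in which the whole argument takes place. [folklore] -/
def Rcirc : Set (Site 2) := bigR j w \ pocket j w

/-- Membership in `R°`. [folklore] -/
theorem mem_Rcirc {z : Site 2} : z ∈ Rcirc j w ↔ z ∈ bigR j w ∧ z ∉ pocket j w := Iff.rfl

/-- The reflection `ρ` of `𝕋` in the row `x₁ = 2j + 1`: `(x₀, x₁) ↦ (x₀ + x₁ - (2j+1), 4j + 2 - x₁)`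
(it preserves the brick coordinate `X = 2x₀ + x₁` and maps the row `Y` to `4j + 2 - Y`). An
involution. [cite: BollobasRiordan2006, Ch. 3 Lemma 4 (reflection in the horizontal axis)] -/
def rhoB : Site 2 ≃ Site 2 where
  toFun z := ![z 0 + z 1 - (2 * j + 1), 4 * j + 2 - z 1]
  invFun z := ![z 0 + z 1 - (2 * j + 1), 4 * j + 2 - z 1]
  left_inv z := by
    ext i; fin_cases i
    · simp; ring
    · simp
  right_inv z := by
    ext i; fin_cases i
    · simp; ring
    · simp

/-- First coordinate of `ρ z`. [folklore] -/
@[simp] theorem rhoB_apply_zero (z : Site 2) : rhoB j z 0 = z 0 + z 1 - (2 * j + 1) := rfl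

/-- Second coordinate of `ρ z`. [folklore] -/
@[simp] theorem rhoB_apply_one (z : Site 2) : rhoB j z 1 = 4 * j + 2 - z 1 := rfl

/-- `ρ` is its own inverse. [folklore] -/
@[simp] theorem rhoB_symm : (rhoB j).symm = rhoB j := rfl

/-- `ρ` is an involution. [folklore] -/
@[simp] theorem rhoB_rhoB (z : Site 2) : rhoB j (rhoB j z) = z := (rhoB j).left_inv z

/-- `ρ` preserves the brick coordinate `X`. [folklore] -/
@[simp] theorem brickX_rhoB (z : Site 2) : brickX (rhoB j z) = brickX z := by
  simp [brickX]; ring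

/-- `ρ` preserves adjacency of `𝕋`. [folklore] -/
theorem triGraph_adj_rhoB {x y : Site 2} (h : triGraph.Adj x y) :
    triGraph.Adj (rhoB j x) (rhoB j y) := by
  rw [triGraph_adj_iff_brick] at h ⊢
  simp only [brickX_rhoB, rhoB_apply_one]
  omega

/-- **`ρ` is an automorphism of the triangular lattice.** [folklore] -/
def rhoBIso : triGraph ≃g triGraph where
  toEquiv := rhoB j
  map_rel_iff' := by
    intro a b
    refine ⟨fun h => ?_, triGraph_adj_rhoB j⟩
    have h' := triGraph_adj_rhoB j h
    change triGraph.Adj (rhoB j (rhoB j a)) (rhoB j (rhoB j b)) at h'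
    rwa [rhoB_rhoB, rhoB_rhoB] at h'

/-- Membership in a `ρ`-image. [folklore] -/
theorem mem_image_rhoB_iff {A : Set (Site 2)} {z : Site 2} : z ∈ rhoB j '' A ↔ rhoB j z ∈ A := by
  constructor
  · rintro ⟨u, hu, rfl⟩; rwa [rhoB_rhoB]
  · intro h; exact ⟨rhoB j z, h, rhoB_rhoB j z⟩

/-- `ρ` preserves `R`. [folklore] -/
theorem rhoB_mem_bigR_iff {z : Site 2} : rhoB j z ∈ bigR j w ↔ z ∈ bigR j w := by
  simp only [mem_bigR, rhoB_apply_zero, rhoB_apply_one]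
  omega

/-- `ρ` preserves the pocket. [folklore] -/
theorem rhoB_mem_pocket_iff {z : Site 2} : rhoB j z ∈ pocket j w ↔ z ∈ pocket j w := by
  simp only [mem_pocket, mem_bigR, rhoB_apply_zero, rhoB_apply_one]
  omega

/-- `ρ` preserves `R°`. [folklore] -/
theorem rhoB_mem_Rcirc_iff {z : Site 2} : rhoB j z ∈ Rcirc j w ↔ z ∈ Rcirc j w := by
  rw [mem_Rcirc, mem_Rcirc, rhoB_mem_bigR_iff, rhoB_mem_pocket_iff]

/-- `ρ` preserves the right end. [folklore] -/
theorem rhoB_mem_bigRight_iff {z : Site 2} : rhoB j z ∈ bigRight j w ↔ z ∈ bigRight j w := by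
  simp only [mem_bigRight, mem_bigR, rhoB_apply_zero, rhoB_apply_one]
  omega

/-- `ρ` fixes the axis row `x₁ = 2j + 1` pointwise. [folklore] -/
theorem rhoB_eq_self_of_row {z : Site 2} (hz : z 1 = 2 * j + 1) : rhoB j z = z := by
  ext i; fin_cases i
  · simp; omega
  · simp; omega

/-- The small hexagon `S = H_j` lies in `R°` (for `w ≥ 2j`). [folklore] -/
theorem hexRegion_subset_Rcirc (hw : 2 * j ≤ w) : hexRegion j ⊆ Rcirc j w := by
  intro z hz
  rw [mem_hexRegion] at hz
  rw [mem_Rcirc, mem_bigR, mem_pocket, mem_bigR]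
  omega

/-- `ρ S` lies in `R°` (for `w ≥ 2j`). [folklore] -/
theorem image_rhoB_hexRegion_subset_Rcirc (hw : 2 * j ≤ w) : rhoB j '' hexRegion j ⊆ Rcirc j w := by
  rintro _ ⟨z, hz, rfl⟩
  exact (rhoB_mem_Rcirc_iff j w).2 (hexRegion_subset_Rcirc j w hw hz)

/-- `S` lies strictly below the axis: its sites have `x₁ ≤ 2j`. [folklore] -/
theorem row_le_of_mem_hexRegion {z : Site 2} (hz : z ∈ hexRegion j) : z 1 ≤ 2 * j :=
  ((mem_hexRegion j).1 hz).2.2.2.1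

/-- `ρ S` lies strictly above the axis: its sites have `2j + 2 ≤ x₁`. [folklore] -/
theorem le_row_of_mem_image_rhoB_hexRegion {z : Site 2} (hz : z ∈ rhoB j '' hexRegion j) :
    2 * (j : ℤ) + 2 ≤ z 1 := by
  rw [mem_image_rhoB_iff] at hz
  have := row_le_of_mem_hexRegion j hz
  simp only [rhoB_apply_one] at this
  omega

/-- `S` and `ρ S` are disjoint. [folklore] -/
theorem disjoint_hexRegion_image_rhoB : Disjoint (hexRegion j) (rhoB j '' hexRegion j) :=
  Set.disjoint_left.2 fun z hz hz' => by
    have h1 := row_le_of_mem_hexRegion j hz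
    have h2 := le_row_of_mem_image_rhoB_hexRegion j hz'
    omega

/-- The left end `s₅ ∪ s₆` of the small hexagon `S` (`hexSide j 4 ∪ hexSide j 5`): the side
`x₀ = 0` (rows `j … 2j`) and the cut `x₀ + x₁ = j` (rows `0 … j`). [folklore] -/
def leftEnd : Set (Site 2) := hexSide j 4 ∪ hexSide j 5

/-- Membership in the left end, arithmetically. [folklore] -/
theorem mem_leftEnd {z : Site 2} :
    z ∈ leftEnd j ↔ z ∈ hexRegion j ∧ (z 0 = 0 ∨ z 0 + z 1 = j) := by
  simp only [leftEnd, hexSide, Set.mem_union, Set.mem_setOf_eq]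
  tauto

/-- The right end `s₂ ∪ s₃` of `S` (`hexSide j 1 ∪ hexSide j 2`). [folklore] -/
def rightEndS : Set (Site 2) := hexSide j 1 ∪ hexSide j 2

/-- Membership in the right end of `S`, arithmetically. [folklore] -/
theorem mem_rightEndS {z : Site 2} :
    z ∈ rightEndS j ↔ z ∈ hexRegion j ∧ (z 0 = 2 * j ∨ z 0 + z 1 = 3 * j) := by
  simp only [rightEndS, hexSide, Set.mem_union, Set.mem_setOf_eq]
  tauto

/-- The gateway site `(0, 2j+1)` on the axis, adjacent to the top-left vertex `(0, 2j)` of `S`, to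
its mirror image `(-1, 2j+2)` and to the pocket. [folklore] -/
def gateway : Site 2 := ![0, 2 * (j : ℤ) + 1]

/-- Coordinates of the gateway. [folklore] -/
@[simp] theorem gateway_apply_zero : gateway j 0 = 0 := rfl

/-- Coordinates of the gateway. [folklore] -/
@[simp] theorem gateway_apply_one : gateway j 1 = 2 * (j : ℤ) + 1 := rfl

/-- The extended left end `LE⁺ = leftEnd ∪ ρ leftEnd ∪ {gateway}`: the part of the boundary of `R°`
towards the pocket. [folklore] -/
def LEplus : Set (Site 2) := leftEnd j ∪ rhoB j '' leftEnd j ∪ {gateway j}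

/-- Membership in `LE⁺`, arithmetically. [folklore] -/
theorem mem_LEplus_iff {z : Site 2} :
    z ∈ LEplus j ↔
      (z ∈ hexRegion j ∧ (z 0 = 0 ∨ z 0 + z 1 = j)) ∨
        (rhoB j z ∈ hexRegion j ∧ (rhoB j z 0 = 0 ∨ rhoB j z 0 + rhoB j z 1 = j)) ∨
          z = gateway j := by
  simp only [LEplus, Set.mem_union, Set.mem_singleton_iff, mem_image_rhoB_iff, mem_leftEnd, or_assoc]

/-- `ρ` preserves `LE⁺`. [folklore] -/
theorem rhoB_mem_LEplus_iff {z : Site 2} : rhoB j z ∈ LEplus j ↔ z ∈ LEplus j := by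
  have hg : rhoB j (gateway j) = gateway j := rhoB_eq_self_of_row j (by simp)
  have hg' : ∀ u : Site 2, rhoB j u = gateway j ↔ u = gateway j := fun u => by
    constructor
    · intro h; rw [← rhoB_rhoB j u, h, hg]
    · intro h; rw [h, hg]
  simp only [mem_LEplus_iff, rhoB_rhoB, hg']
  tauto

/-- `LE⁺ ⊆ R°` (for `w ≥ 2j`). [folklore] -/
theorem LEplus_subset_Rcirc (hw : 2 * j ≤ w) : LEplus j ⊆ Rcirc j w := by
  intro z hz
  rcases (mem_LEplus_iff j).1 hz with ⟨hz, -⟩ | ⟨hz, -⟩ | rfl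
  · exact hexRegion_subset_Rcirc j w hw hz
  · rw [← rhoB_mem_Rcirc_iff]; exact hexRegion_subset_Rcirc j w hw hz
  · rw [mem_Rcirc, mem_bigR, mem_pocket, mem_bigR]
    simp only [gateway_apply_zero, gateway_apply_one]
    omega

/-- Arithmetic core of the entry lemma: in coordinates, a site of `R \ pocket` adjacent to a pocket
site satisfies one of the four boundary descriptions (left side of `S`, lower-left cut of `S`, their
mirror images, or the gateway). [folklore] -/
theorem entry_arith {a0 a1 b0 b1 : ℤ} {j w : ℕ}
    (ha : 0 ≤ a1 ∧ a1 ≤ 4 * j + 2 ∧ -((j : ℤ) + 1) ≤ a0 ∧ a0 ≤ w ∧ (j : ℤ) ≤ a0 + a1 ∧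
      a0 + a1 ≤ w + 2 * j + 1)
    (hap : ¬ (((j : ℤ) ≤ a1 ∧ a1 ≤ 2 * j + 1 ∧ a0 ≤ -1) ∨
      (2 * (j : ℤ) + 1 ≤ a1 ∧ a1 ≤ 3 * j + 2 ∧ a0 + a1 ≤ 2 * j)))
    (hb : ((j : ℤ) ≤ b1 ∧ b1 ≤ 2 * j + 1 ∧ b0 ≤ -1) ∨
      (2 * (j : ℤ) + 1 ≤ b1 ∧ b1 ≤ 3 * j + 2 ∧ b0 + b1 ≤ 2 * j))
    (hb' : (j : ℤ) ≤ b0 + b1 ∧ -((j : ℤ) + 1) ≤ b0)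
    (hab : (b1 = a1 ∧ (2 * b0 + b1 = 2 * a0 + a1 + 2 ∨ 2 * b0 + b1 + 2 = 2 * a0 + a1)) ∨
      ((b1 = a1 + 1 ∨ b1 + 1 = a1) ∧ (2 * b0 + b1 = 2 * a0 + a1 + 1 ∨ 2 * b0 + b1 + 1 = 2 * a0 + a1))) :
    (a0 = 0 ∧ (j : ℤ) ≤ a1 ∧ a1 ≤ 2 * j) ∨ (a0 + a1 = j ∧ 0 ≤ a1 ∧ a1 ≤ j) ∨
      (a0 + a1 = 2 * j + 1 ∧ 2 * (j : ℤ) + 2 ≤ a1 ∧ a1 ≤ 3 * j + 2) ∨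
        (a0 = -((j : ℤ) + 1) ∧ 3 * (j : ℤ) + 2 ≤ a1 ∧ a1 ≤ 4 * j + 2) ∨
          (a0 = 0 ∧ a1 = 2 * j + 1) := by
  rcases hab with ⟨h1, h0 | h0⟩ | ⟨h1 | h1, h0 | h0⟩ <;> rcases hb with hb | hb <;> omega

/-- **Entry lemma.** A site of `R°` adjacent to a site of the pocket lies in `LE⁺`: one enters the
pocket only through the left ends of `S`, `ρS` or the gateway. [folklore] -/
theorem mem_LEplus_of_adj_pocket {a b : Site 2} (ha : a ∈ Rcirc j w) (hb : b ∈ pocket j w)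
    (hab : triGraph.Adj a b) : a ∈ LEplus j := by
  rw [mem_Rcirc, mem_bigR, mem_pocket] at ha
  obtain ⟨ha, hap⟩ := ha
  have hap' : ¬ (((j : ℤ) ≤ a 1 ∧ a 1 ≤ 2 * j + 1 ∧ a 0 ≤ -1) ∨
      (2 * (j : ℤ) + 1 ≤ a 1 ∧ a 1 ≤ 3 * j + 2 ∧ a 0 + a 1 ≤ 2 * j)) := fun h => hap ⟨ha, h⟩
  rw [mem_pocket, mem_bigR] at hb
  rw [triGraph_adj_iff_brick] at hab
  simp only [brickX] at hab
  have key := entry_arith (j := j) (w := w) ha hap' hb.2 ⟨hb.1.2.2.2.2.1, hb.1.2.2.1⟩ hab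
  rw [mem_LEplus_iff, mem_hexRegion, mem_hexRegion]
  simp only [rhoB_apply_zero, rhoB_apply_one]
  rcases key with h | h | h | h | h
  · left; omega
  · left; omega
  · right; left; omega
  · right; left; omega
  · right; right
    ext i; fin_cases i
    · simpa using h.1
    · simpa using h.2

end Regions

/-! ### The conditioning: left-end white cluster, frozen set, sealed region, symmetric domain -/

section Events

variable (j w : ℕ)

/-- **The white cluster of the left end of `S` inside `S`**: the sites of `S` joined to a site of
`leftEnd = s₅ ∪ s₆` by a `𝕋`-path of closed sites of `S` (the analogue of Werner's "water poured
in", here from the left end; its black boundary contains Bollobás–Riordan's left-most vertical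
crossing `LV(S)`, see `exists_pathIn_Fset_diff`). [cite: BollobasRiordan2006, Ch. 3 Lemma 4 (LV(S))] -/
def Lcl (ω : SiteConfig (Site 2)) : Set (Site 2) :=
  {x | ∃ t ∈ leftEnd j, PathIn triGraph (hexRegion j ∩ ωᶜ) t x}

/-- The event `{L = L₀}`. [cite: BollobasRiordan2006, Ch. 3 Lemma 4 (the event LV(S) = P₁)] -/
def Eev (L₀ : Set (Site 2)) : Set (SiteConfig (Site 2)) := {ω | Lcl j ω = L₀}

/-- The frozen set `F(L₀) = L₀ ∪ ∂_S L₀ ∪ leftEnd`. [cite: BollobasRiordan2006, Ch. 3 Lemma 4] -/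
def Fset (L₀ : Set (Site 2)) : Set (Site 2) :=
  L₀ ∪ {z | z ∈ hexRegion j ∧ ∃ l ∈ L₀, triGraph.Adj z l} ∪ leftEnd j

/-- The **unexplored part of `S`**: the sites of `S \ F(L₀)` joined to the right end `s₂ ∪ s₃` of
`S` by a `𝕋`-path inside `S \ F(L₀)` (Bollobás–Riordan's "`S` to the right of `P₁`").
[cite: BollobasRiordan2006, Ch. 3 Lemma 4] -/
def Reach (L₀ : Set (Site 2)) : Set (Site 2) :=
  {z | ∃ e ∈ rightEndS j, e ∉ Fset j L₀ ∧ PathIn triGraph (hexRegion j \ Fset j L₀) e z}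

/-- The **sealed (explored) part of `S`**: `S \ Reach(L₀)`; it contains `F(L₀)` and the pockets
enclosed between `F(L₀)` and the boundary of `S` ("`S` to the left of `P₁`").
[cite: BollobasRiordan2006, Ch. 3 Lemma 4] -/
def Seal (L₀ : Set (Site 2)) : Set (Site 2) := hexRegion j \ Reach j L₀

/-- The **blocked axis sites**: sites of the axis row `x₁ = 2j + 1` (in `R°`) both of whose
neighbours in the top row of `S`, `(x₀, 2j)` and `(x₀ + 1, 2j)`, are sealed (the analogue of the
part of the axis to the left of Bollobás–Riordan's joining bond). [cite: BollobasRiordan2006, Ch. 3 Lemma 4] -/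
def AxBlock (L₀ : Set (Site 2)) : Set (Site 2) :=
  {c | c ∈ Rcirc j w ∧ c 1 = 2 * j + 1 ∧ (![c 0, 2 * j] : Site 2) ∈ Seal j L₀ ∧
    (![c 0 + 1, 2 * j] : Site 2) ∈ Seal j L₀}

/-- **The barrier** `Seal ∪ ρ Seal ∪ AxBlock` (Bollobás–Riordan's `P = P₁ ∪ P₁' ∪ {bond}` together
with everything to its left). [cite: BollobasRiordan2006, Ch. 3 Lemma 4] -/
def Barrier (L₀ : Set (Site 2)) : Set (Site 2) := Seal j L₀ ∪ rhoB j '' Seal j L₀ ∪ AxBlock j w L₀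

/-- The symmetric domain `D(L₀) = R° \ Barrier(L₀)` ("`R` to the right of `P`").
[cite: BollobasRiordan2006, Ch. 3 Lemma 4] -/
def Dset (L₀ : Set (Site 2)) : Set (Site 2) := Rcirc j w \ Barrier j w L₀

/-- Start sites of `Y(L₀)`: sites of `D(L₀)` adjacent to the frozen set. [cite: BollobasRiordan2006, Ch. 3 Lemma 4] -/
def Aset (L₀ : Set (Site 2)) : Set (Site 2) :=
  {z | z ∈ Dset j w L₀ ∧ ∃ m ∈ Fset j L₀, triGraph.Adj z m}

/-- Start sites of the mirror event `Y'(L₀)`: sites of `D(L₀)` adjacent to `ρ F(L₀)`. [cite: BollobasRiordan2006, Ch. 3 Lemma 4] -/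
def A'set (L₀ : Set (Site 2)) : Set (Site 2) :=
  {z | z ∈ Dset j w L₀ ∧ ∃ m ∈ rhoB j '' Fset j L₀, triGraph.Adj z m}

/-- Target sites: sites of `D(L₀)` on the right end of `R`. [cite: BollobasRiordan2006, Ch. 3 Lemma 4] -/
def Tset (L₀ : Set (Site 2)) : Set (Site 2) := {z | z ∈ Dset j w L₀ ∧ z ∈ bigRight j w}

/-- **Bollobás–Riordan's event `Y(P₁)`** in cluster form: an open path inside `D(L₀)` from a site
adjacent to `F(L₀)` to the right end of `R`. [cite: BollobasRiordan2006, Ch. 3 Lemma 4 (Y(P₁))] -/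
def Yev (L₀ : Set (Site 2)) : Set (SiteConfig (Site 2)) :=
  {ω | ∃ x ∈ Aset j w L₀, ∃ y ∈ Tset j w L₀, PathIn triGraph (Dset j w L₀ ∩ ω) x y}

/-- The mirror event `Y'(P₁)`: an open path inside `D(L₀)` from a site adjacent to `ρ F(L₀)` to the
right end. [cite: BollobasRiordan2006, Ch. 3 Lemma 4] -/
def Y'ev (L₀ : Set (Site 2)) : Set (SiteConfig (Site 2)) :=
  {ω | ∃ x ∈ A'set j w L₀, ∃ y ∈ Tset j w L₀, PathIn triGraph (Dset j w L₀ ∩ ω) x y}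

/-- **The input event `E°`**: an open path inside `R°` from the right end of `R` to the extended
left end `LE⁺` (this replaces Bollobás–Riordan's `H(R)`, "some open path crosses `R` from right
to left — this path must meet `P`"). [cite: BollobasRiordan2006, Ch. 3 Lemma 4 (H(R))] -/
def Ecirc : Set (SiteConfig (Site 2)) :=
  {ω | ∃ r ∈ bigRight j w, ∃ l ∈ LEplus j, PathIn triGraph (Rcirc j w ∩ ω) r l}

variable {j w}

/-- Membership in the frozen set. [cite: BollobasRiordan2006, Ch. 3 Lemma 4] -/
theorem mem_Fset {L₀ : Set (Site 2)} {z : Site 2} :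
    z ∈ Fset j L₀ ↔ z ∈ L₀ ∨ (z ∈ hexRegion j ∧ ∃ l ∈ L₀, triGraph.Adj z l) ∨ z ∈ leftEnd j := by
  simp only [Fset, Set.mem_union, Set.mem_setOf_eq, or_assoc]

/-- The left end lies in `S`. [folklore] -/
theorem leftEnd_subset_hexRegion : leftEnd j ⊆ hexRegion j := fun _ hz => ((mem_leftEnd j).1 hz).1

/-- The right end lies in `S`. [folklore] -/
theorem rightEndS_subset_hexRegion : rightEndS j ⊆ hexRegion j := fun _ hz => ((mem_rightEndS j).1 hz).1

/-- The frozen set lies in `S` (for `L₀ ⊆ S`). [cite: BollobasRiordan2006, Ch. 3 Lemma 4] -/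
theorem Fset_subset_hexRegion {L₀ : Set (Site 2)} (hL : L₀ ⊆ hexRegion j) : Fset j L₀ ⊆ hexRegion j := by
  intro z hz
  rcases mem_Fset.1 hz with h | h | h
  · exact hL h
  · exact h.1
  · exact leftEnd_subset_hexRegion h

/-- `Reach ⊆ S \ F`. [cite: BollobasRiordan2006, Ch. 3 Lemma 4] -/
theorem Reach_subset {L₀ : Set (Site 2)} : Reach j L₀ ⊆ hexRegion j \ Fset j L₀ :=
  fun _ ⟨_, _, _, hp⟩ => hp.right_mem

/-- A site of the right end of `S` outside `F` is in `Reach`. [cite: BollobasRiordan2006, Ch. 3 Lemma 4] -/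
theorem mem_Reach_of_rightEndS {L₀ : Set (Site 2)} {e : Site 2} (he : e ∈ rightEndS j) (heF : e ∉ Fset j L₀) :
    e ∈ Reach j L₀ :=
  ⟨e, he, heF, PathIn.refl ⟨rightEndS_subset_hexRegion he, heF⟩⟩

/-- `Reach` is closed under adjacency inside `S \ F`. [cite: BollobasRiordan2006, Ch. 3 Lemma 4] -/
theorem mem_Reach_of_adj {L₀ : Set (Site 2)} {z z' : Site 2} (hz : z ∈ Reach j L₀) (hz' : z' ∈ hexRegion j)
    (hz'F : z' ∉ Fset j L₀) (hadj : triGraph.Adj z z') : z' ∈ Reach j L₀ := by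
  obtain ⟨e, he, heF, hp⟩ := hz
  exact ⟨e, he, heF, hp.tail hadj ⟨hz', hz'F⟩⟩

/-- Membership in the sealed region. [cite: BollobasRiordan2006, Ch. 3 Lemma 4] -/
theorem mem_Seal {L₀ : Set (Site 2)} {z : Site 2} : z ∈ Seal j L₀ ↔ z ∈ hexRegion j ∧ z ∉ Reach j L₀ := Iff.rfl

/-- `Seal ⊆ S`. [cite: BollobasRiordan2006, Ch. 3 Lemma 4] -/
theorem Seal_subset_hexRegion {L₀ : Set (Site 2)} : Seal j L₀ ⊆ hexRegion j := fun _ hz => hz.1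

/-- `F ⊆ Seal` (for `L₀ ⊆ S`). [cite: BollobasRiordan2006, Ch. 3 Lemma 4] -/
theorem Fset_subset_Seal {L₀ : Set (Site 2)} (hL : L₀ ⊆ hexRegion j) : Fset j L₀ ⊆ Seal j L₀ :=
  fun _ hz => ⟨Fset_subset_hexRegion hL hz, fun h => (Reach_subset h).2 hz⟩

/-- A sealed site outside `F` adjacent to a site of `Reach` does not exist. [cite: BollobasRiordan2006, Ch. 3 Lemma 4] -/
theorem mem_Fset_of_mem_Seal_of_adj {L₀ : Set (Site 2)} {z z' : Site 2} (hz : z ∈ Seal j L₀) (hz' : z' ∈ Reach j L₀)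
    (hadj : triGraph.Adj z' z) : z ∈ Fset j L₀ := by
  by_contra hzF
  exact hz.2 (mem_Reach_of_adj hz' hz.1 hzF hadj)

/-- A sealed site of the right end of `S` is frozen. [cite: BollobasRiordan2006, Ch. 3 Lemma 4] -/
theorem mem_Fset_of_mem_Seal_of_rightEndS {L₀ : Set (Site 2)} {z : Site 2} (hz : z ∈ Seal j L₀) (hzR : z ∈ rightEndS j) :
    z ∈ Fset j L₀ := by
  by_contra hzF
  exact hz.2 (mem_Reach_of_rightEndS hzR hzF)

/-- Membership in `AxBlock`. [cite: BollobasRiordan2006, Ch. 3 Lemma 4] -/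
theorem mem_AxBlock {L₀ : Set (Site 2)} {c : Site 2} :
    c ∈ AxBlock j w L₀ ↔ c ∈ Rcirc j w ∧ c 1 = 2 * j + 1 ∧ (![c 0, 2 * j] : Site 2) ∈ Seal j L₀ ∧
      (![c 0 + 1, 2 * j] : Site 2) ∈ Seal j L₀ := Iff.rfl

/-- Membership in the barrier. [cite: BollobasRiordan2006, Ch. 3 Lemma 4] -/
theorem mem_Barrier {L₀ : Set (Site 2)} {z : Site 2} :
    z ∈ Barrier j w L₀ ↔ z ∈ Seal j L₀ ∨ z ∈ rhoB j '' Seal j L₀ ∨ z ∈ AxBlock j w L₀ := by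
  simp only [Barrier, Set.mem_union, or_assoc]

/-- Membership in the symmetric domain. [cite: BollobasRiordan2006, Ch. 3 Lemma 4] -/
theorem mem_Dset {L₀ : Set (Site 2)} {z : Site 2} :
    z ∈ Dset j w L₀ ↔ z ∈ Rcirc j w ∧ z ∉ Barrier j w L₀ := Iff.rfl

/-- `D ⊆ R°`. [cite: BollobasRiordan2006, Ch. 3 Lemma 4] -/
theorem Dset_subset_Rcirc {L₀ : Set (Site 2)} : Dset j w L₀ ⊆ Rcirc j w := fun _ hz => (mem_Dset.1 hz).1

/-- `D` misses `F` (for `L₀ ⊆ S`). [cite: BollobasRiordan2006, Ch. 3 Lemma 4] -/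
theorem not_mem_Fset_of_mem_Dset {L₀ : Set (Site 2)} (hL : L₀ ⊆ hexRegion j) {z : Site 2} (hz : z ∈ Dset j w L₀) :
    z ∉ Fset j L₀ := fun h => (mem_Dset.1 hz).2 (mem_Barrier.2 (Or.inl (Fset_subset_Seal hL h)))

/-- A site of `D` inside `S` is in `Reach`. [cite: BollobasRiordan2006, Ch. 3 Lemma 4] -/
theorem mem_Reach_of_mem_Dset {L₀ : Set (Site 2)} {z : Site 2} (hz : z ∈ Dset j w L₀) (hzS : z ∈ hexRegion j) :
    z ∈ Reach j L₀ := by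
  by_contra h
  exact (mem_Dset.1 hz).2 (mem_Barrier.2 (Or.inl ⟨hzS, h⟩))

/-- `ρ` fixes the blocked axis sites. [folklore] -/
theorem rhoB_eq_self_of_mem_AxBlock {L₀ : Set (Site 2)} {c : Site 2} (hc : c ∈ AxBlock j w L₀) : rhoB j c = c :=
  rhoB_eq_self_of_row j hc.2.1

/-- `ρ` preserves the barrier. [cite: BollobasRiordan2006, Ch. 3 Lemma 4] -/
theorem rhoB_mem_Barrier_iff {L₀ : Set (Site 2)} {z : Site 2} : rhoB j z ∈ Barrier j w L₀ ↔ z ∈ Barrier j w L₀ := by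
  have hax : ∀ u : Site 2, rhoB j u ∈ AxBlock j w L₀ ↔ u ∈ AxBlock j w L₀ := by
    intro u
    constructor
    · intro h
      have h' := rhoB_eq_self_of_mem_AxBlock h
      rw [rhoB_rhoB] at h'
      rwa [← h'] at h
    · intro h
      rwa [rhoB_eq_self_of_mem_AxBlock h]
  rw [mem_Barrier, mem_Barrier, mem_image_rhoB_iff, rhoB_rhoB, mem_image_rhoB_iff, hax]
  tauto

/-- `ρ` preserves `D(L₀)`. [cite: BollobasRiordan2006, Ch. 3 Lemma 4] -/
theorem rhoB_mem_Dset_iff {L₀ : Set (Site 2)} {z : Site 2} : rhoB j z ∈ Dset j w L₀ ↔ z ∈ Dset j w L₀ := by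
  rw [mem_Dset, mem_Dset, rhoB_mem_Rcirc_iff, rhoB_mem_Barrier_iff]

/-- `ρ(D ∩ A) = D ∩ ρ A`. [cite: BollobasRiordan2006, Ch. 3 Lemma 4] -/
theorem image_rhoB_Dset_inter {L₀ : Set (Site 2)} (A : Set (Site 2)) :
    rhoB j '' (Dset j w L₀ ∩ A) = Dset j w L₀ ∩ rhoB j '' A := by
  ext z
  rw [mem_image_rhoB_iff, Set.mem_inter_iff, Set.mem_inter_iff, rhoB_mem_Dset_iff, mem_image_rhoB_iff]

/-- `ρ` maps `Aset` onto `A'set`. [cite: BollobasRiordan2006, Ch. 3 Lemma 4] -/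
theorem rhoB_mem_A'set_iff {L₀ : Set (Site 2)} {z : Site 2} : rhoB j z ∈ A'set j w L₀ ↔ z ∈ Aset j w L₀ := by
  simp only [A'set, Aset, Set.mem_setOf_eq, rhoB_mem_Dset_iff]
  refine and_congr_right fun _ => ⟨?_, ?_⟩
  · rintro ⟨m, hm, hadj⟩
    refine ⟨rhoB j m, (mem_image_rhoB_iff j).1 hm, ?_⟩
    have := triGraph_adj_rhoB j hadj
    rwa [rhoB_rhoB] at this
  · rintro ⟨m, hm, hadj⟩
    exact ⟨rhoB j m, ⟨m, hm, rfl⟩, triGraph_adj_rhoB j hadj⟩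

/-- `ρ` preserves `Tset`. [cite: BollobasRiordan2006, Ch. 3 Lemma 4] -/
theorem rhoB_mem_Tset_iff {L₀ : Set (Site 2)} {z : Site 2} : rhoB j z ∈ Tset j w L₀ ↔ z ∈ Tset j w L₀ := by
  simp only [Tset, Set.mem_setOf_eq, rhoB_mem_Dset_iff, rhoB_mem_bigRight_iff]

/-- **`Y'` is the `ρ`-preimage of `Y`.** [cite: BollobasRiordan2006, Ch. 3 Lemma 4 ("by symmetry")] -/
theorem Y'ev_eq_preimage (L₀ : Set (Site 2)) :
    Y'ev j w L₀ = SiteConfig.relabel (rhoB j) ⁻¹' Yev j w L₀ := by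
  ext ω
  simp only [Set.mem_preimage, Y'ev, Yev, Set.mem_setOf_eq, SiteConfig.relabel_apply]
  constructor
  · rintro ⟨x, hx, y, hy, hp⟩
    refine ⟨rhoB j x, ?_, rhoB j y, (rhoB_mem_Tset_iff).2 hy, ?_⟩
    · rw [← rhoB_rhoB j x] at hx
      exact (rhoB_mem_A'set_iff).1 hx
    · have := hp.map_adj (rhoB j) fun _ _ h => triGraph_adj_rhoB j h
      rwa [image_rhoB_Dset_inter] at this
  · rintro ⟨x, hx, y, hy, hp⟩
    refine ⟨rhoB j x, (rhoB_mem_A'set_iff).2 hx, rhoB j y, (rhoB_mem_Tset_iff).2 hy, ?_⟩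
    have := hp.map_adj (rhoB j) fun _ _ h => triGraph_adj_rhoB j h
    rw [image_rhoB_Dset_inter] at this
    have hωω : rhoB j '' (rhoB j '' ω) = ω := by
      rw [← Set.image_comp]
      convert Set.image_id ω
      ext z
      simp
    rwa [hωω] at this

/-- **`P(Y') = P(Y)`** (reflection invariance of `P_p`). [cite: BollobasRiordan2006, Ch. 3 Lemma 4 ("by symmetry")] -/
theorem real_Y'ev (p : unitInterval) (L₀ : Set (Site 2)) :
    (triSitePercolation p).real (Y'ev j w L₀) = (triSitePercolation p).real (Yev j w L₀) := by
  rw [Y'ev_eq_preimage, triSitePercolation, sitePercolation_real_preimage_relabel]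

/-- The input event is increasing. [folklore] -/
theorem isUpperSet_Ecirc : IsUpperSet (Ecirc j w) := by
  rintro ω ω' hle ⟨r, hr, l, hl, hp⟩
  exact ⟨r, hr, l, hl, hp.mono (Set.inter_subset_inter_right _ hle)⟩

end Events

/-! ### The left-end white cluster: basic API, determinacy, independence -/

section Cluster

variable {j w : ℕ}

/-- `L ⊆ S`. [cite: BollobasRiordan2006, Ch. 3 Lemma 4] -/
theorem Lcl_subset_hexRegion (ω : SiteConfig (Site 2)) : Lcl j ω ⊆ hexRegion j :=
  fun _ ⟨_, _, h⟩ => h.right_mem.1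

/-- Sites of `L` are white. [cite: BollobasRiordan2006, Ch. 3 Lemma 4] -/
theorem not_mem_of_mem_Lcl {ω : SiteConfig (Site 2)} {x : Site 2} (h : x ∈ Lcl j ω) : x ∉ ω := by
  obtain ⟨_, -, h⟩ := h; exact h.right_mem.2

/-- White sites of the left end are in `L`. [cite: BollobasRiordan2006, Ch. 3 Lemma 4] -/
theorem mem_Lcl_of_leftEnd {ω : SiteConfig (Site 2)} {t : Site 2} (ht : t ∈ leftEnd j) (htω : t ∉ ω) :
    t ∈ Lcl j ω :=
  ⟨t, ht, PathIn.refl ⟨leftEnd_subset_hexRegion ht, htω⟩⟩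

/-- White sites of `S` adjacent to `L` are in `L`. [cite: BollobasRiordan2006, Ch. 3 Lemma 4] -/
theorem mem_Lcl_of_adj {ω : SiteConfig (Site 2)} {x y : Site 2} (hx : x ∈ Lcl j ω) (hy : y ∈ hexRegion j)
    (hyω : y ∉ ω) (hxy : triGraph.Adj x y) : y ∈ Lcl j ω := by
  obtain ⟨t, ht, h⟩ := hx
  exact ⟨t, ht, h.tail hxy ⟨hy, hyω⟩⟩

/-- Every site of `L` is joined to a left-end site *inside `L`*. [cite: BollobasRiordan2006, Ch. 3 Lemma 4] -/
theorem exists_pathIn_Lcl {ω : SiteConfig (Site 2)} {x : Site 2} (hx : x ∈ Lcl j ω) :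
    ∃ t ∈ leftEnd j, PathIn triGraph (Lcl j ω) t x := by
  obtain ⟨t, ht, h⟩ := hx
  exact ⟨t, ht, (h.inter_of_forall (C := Lcl j ω) fun u hu => ⟨t, ht, hu⟩).mono Set.inter_subset_right⟩

/-- On `{L = L₀}`, the sites of `L₀` are white. [cite: BollobasRiordan2006, Ch. 3 Lemma 4] -/
theorem white_of_mem {ω : SiteConfig (Site 2)} {L₀ : Set (Site 2)} (hE : ω ∈ Eev j L₀) {z : Site 2} (hz : z ∈ L₀) :
    z ∉ ω := by
  have hE' : Lcl j ω = L₀ := hE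
  rw [← hE'] at hz
  exact not_mem_of_mem_Lcl hz

/-- On `{L = L₀}`, the sites of `F(L₀) \ L₀` are black. [cite: BollobasRiordan2006, Ch. 3 Lemma 4] -/
theorem black_of_mem_Fset {ω : SiteConfig (Site 2)} {L₀ : Set (Site 2)} (hE : ω ∈ Eev j L₀) {z : Site 2}
    (hz : z ∈ Fset j L₀) (hzL : z ∉ L₀) : z ∈ ω := by
  by_contra hzω
  have hE' : Lcl j ω = L₀ := hE
  rcases mem_Fset.1 hz with h | ⟨hzR, l, hl, hadj⟩ | ht
  · exact hzL h
  · rw [← hE'] at hl hzL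
    exact hzL (mem_Lcl_of_adj hl hzR hzω hadj.symm)
  · rw [← hE'] at hzL
    exact hzL (mem_Lcl_of_leftEnd ht hzω)

/-- If two configurations agree on `F(L₀)` and the first has left-end cluster `L₀ ⊆ S`, so has the
second. [cite: BollobasRiordan2006, Ch. 3 Lemma 4] -/
theorem Lcl_eq_of_agree {ω ω' : SiteConfig (Site 2)} {L₀ : Set (Site 2)} (hL : L₀ ⊆ hexRegion j)
    (hagree : ∀ z ∈ Fset j L₀, z ∈ ω ↔ z ∈ ω') (h : Lcl j ω = L₀) : Lcl j ω' = L₀ := by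
  have hE : ω ∈ Eev j L₀ := h
  apply Set.Subset.antisymm
  · rintro x ⟨t, ht, hp⟩
    refine hp.mem_of_closed (C := L₀) ?_ ?_
    · have htF : t ∈ Fset j L₀ := mem_Fset.2 (Or.inr (Or.inr ht))
      have htω : t ∉ ω := fun h' => hp.left_mem.2 ((hagree t htF).1 h')
      rw [← h]; exact mem_Lcl_of_leftEnd ht htω
    · intro x y hx hy hxy
      have hyF : y ∈ Fset j L₀ := mem_Fset.2 (Or.inr (Or.inl ⟨hy.1, x, hx, hxy.symm⟩))
      have hyω : y ∉ ω := fun h' => hy.2 ((hagree y hyF).1 h')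
      have hx' : x ∈ Lcl j ω := by rw [h]; exact hx
      rw [← h]; exact mem_Lcl_of_adj hx' hy.1 hyω hxy
  · intro x hx
    have hx' : x ∈ Lcl j ω := by rw [h]; exact hx
    obtain ⟨t, ht, hp⟩ := exists_pathIn_Lcl hx'
    rw [h] at hp
    refine ⟨t, ht, hp.mono fun z hz => ⟨hL hz, fun hzω' => ?_⟩⟩
    have hzF : z ∈ Fset j L₀ := mem_Fset.2 (Or.inl hz)
    exact white_of_mem hE hz ((hagree z hzF).2 hzω')

open Classical in
/-- The frozen set `F(L₀)` as a `Finset`, for a finite candidate cluster. [cite: BollobasRiordan2006, Ch. 3 Lemma 4] -/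
def Ffin (j : ℕ) (T : Finset (Site 2)) : Finset (Site 2) :=
  T ∪ (hexFinset j).filter (fun z => ∃ l ∈ T, triGraph.Adj z l) ∪
    (hexFinset j).filter (fun z => z 0 = 0 ∨ z 0 + z 1 = j)

/-- `Ffin T` is `Fset ↑T`. [cite: BollobasRiordan2006, Ch. 3 Lemma 4] -/
theorem coe_Ffin (T : Finset (Site 2)) : (↑(Ffin j T) : Set (Site 2)) = Fset j ↑T := by
  ext z
  simp only [Ffin, Finset.coe_union, Finset.coe_filter, Set.mem_union, Set.mem_setOf_eq,
    Finset.mem_coe, mem_Fset, mem_leftEnd, ← Finset.mem_coe (s := hexFinset j), coe_hexFinset,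
    or_assoc]

/-- A finite box containing `R`. [folklore] -/
def bigBox (j w : ℕ) : Finset (Site 2) := Finset.Icc ![-((j : ℤ) + 1), 0] ![(w : ℤ), 4 * j + 2]

/-- `R` lies in the box. [folklore] -/
theorem bigR_subset_bigBox : bigR j w ⊆ ↑(bigBox j w) := by
  intro z hz
  rw [mem_bigR] at hz
  rw [Finset.mem_coe, bigBox, Finset.mem_Icc]
  refine ⟨fun i => ?_, fun i => ?_⟩ <;> fin_cases i <;> simp <;> omega

open Classical in
/-- The symmetric domain `D(L₀)` as a `Finset`. [cite: BollobasRiordan2006, Ch. 3 Lemma 4] -/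
def Dfin (j w : ℕ) (T : Finset (Site 2)) : Finset (Site 2) := (bigBox j w).filter fun z => z ∈ Dset j w ↑T

/-- `Dfin T` is `Dset ↑T`. [cite: BollobasRiordan2006, Ch. 3 Lemma 4] -/
theorem coe_Dfin (T : Finset (Site 2)) : (↑(Dfin j w T) : Set (Site 2)) = Dset j w ↑T := by
  ext z
  simp only [Dfin, Finset.coe_filter, Set.mem_setOf_eq]
  exact ⟨fun h => h.2, fun h => ⟨bigR_subset_bigBox (Dset_subset_Rcirc h).1, h⟩⟩

/-- The frozen set and the symmetric domain are disjoint. [cite: BollobasRiordan2006, Ch. 3 Lemma 4] -/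
theorem disjoint_Ffin_Dfin {T : Finset (Site 2)} (hT : (↑T : Set (Site 2)) ⊆ hexRegion j) :
    Disjoint (Ffin j T) (Dfin j w T) := by
  rw [← Finset.disjoint_coe, coe_Ffin, coe_Dfin, Set.disjoint_left]
  intro z hzF hzD
  exact not_mem_Fset_of_mem_Dset hT hzD hzF

/-- **`{L = L₀}` is determined by the sites of `F(L₀)`.** [cite: BollobasRiordan2006, Ch. 3 Lemma 4 ({LV(S) = P₁} "does not depend on the states of bonds of S to the right of P₁")] -/
theorem determinedBy_Eev {T : Finset (Site 2)} (hT : (↑T : Set (Site 2)) ⊆ hexRegion j) :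
    DeterminedBy (Eev j ↑T) ↑(Ffin j T) := by
  rw [determinedBy_iff]
  intro ω ω' h
  rw [coe_Ffin] at h
  have hagree : ∀ z ∈ Fset j ↑T, z ∈ ω ↔ z ∈ ω' := fun z hz =>
    ⟨fun hzω => ((Set.ext_iff.1 h z).1 ⟨hzω, hz⟩).1, fun hzω => ((Set.ext_iff.1 h z).2 ⟨hzω, hz⟩).1⟩
  exact ⟨fun hω => Lcl_eq_of_agree hT hagree hω,
    fun hω' => Lcl_eq_of_agree hT (fun z hz => (hagree z hz).symm) hω'⟩

/-- `{L = L₀}` is measurable. [cite: BollobasRiordan2006, Ch. 3 Lemma 4] -/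
theorem measurableSet_Eev {T : Finset (Site 2)} (hT : (↑T : Set (Site 2)) ⊆ hexRegion j) :
    MeasurableSet (Eev j ↑T) :=
  (determinedBy_Eev hT).measurableSet_of_finset

/-- **`Y(L₀)` is determined by the sites of `D(L₀)`.** [cite: BollobasRiordan2006, Ch. 3 Lemma 4 ("Y(P₁) depends only on the states of bonds to the right of P")] -/
theorem determinedBy_Yev (T : Finset (Site 2)) : DeterminedBy (Yev j w ↑T) ↑(Dfin j w T) := by
  rw [determinedBy_iff]
  intro ω ω' h
  rw [coe_Dfin] at h
  have : Dset j w ↑T ∩ ω = Dset j w ↑T ∩ ω' := by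
    rw [Set.inter_comm, h, Set.inter_comm]
  simp only [Yev, Set.mem_setOf_eq, this]

/-- `Y(L₀)` is measurable. [cite: BollobasRiordan2006, Ch. 3 Lemma 4] -/
theorem measurableSet_Yev (T : Finset (Site 2)) : MeasurableSet (Yev j w ↑T) :=
  (determinedBy_Yev T).measurableSet_of_finset

/-- **Independence of `{L = L₀}` and `Y(L₀)`** (disjoint supports; Bollobás–Riordan: "as the states
of these bonds are independent of `{LV(S) = P₁}`,
`P(Y(P₁) | LV(S) = P₁) = P(Y(P₁))`"). [cite: BollobasRiordan2006, Ch. 3 Lemma 4] -/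
theorem real_Eev_inter_Yev (p : unitInterval) {T : Finset (Site 2)} (hT : (↑T : Set (Site 2)) ⊆ hexRegion j) :
    (triSitePercolation p).real (Eev j ↑T ∩ Yev j w ↑T) =
      (triSitePercolation p).real (Eev j ↑T) * (triSitePercolation p).real (Yev j w ↑T) :=
  sitePercolation_real_inter_of_disjoint p (determinedBy_Eev hT) (determinedBy_Yev T)
    (disjoint_Ffin_Dfin hT)

/-- Distinct candidate clusters give disjoint events `{L = L₀}`. [cite: BollobasRiordan2006, Ch. 3 Lemma 4] -/
theorem disjoint_Eev {T T' : Finset (Site 2)} (h : T ≠ T') : Disjoint (Eev j (↑T : Set (Site 2))) (Eev j ↑T') :=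
  Set.disjoint_left.2 fun _ h1 h2 => h (Finset.coe_injective (h1.symm.trans h2))

end Cluster


/-! ### Covering: `E° ⊆ Y(L₀) ∪ Y'(L₀)` -/

section Covering

variable {j w : ℕ}

/-- A site with prescribed coordinates. [folklore] -/
theorem site_eq_mk {z : Site 2} {a b : ℤ} (h0 : z 0 = a) (h1 : z 1 = b) : z = ![a, b] := by
  ext i; fin_cases i
  · simpa using h0
  · simpa using h1

/-- Top-row sites of `S`: `(x, 2j) ∈ S ↔ 0 ≤ x ≤ j`. [folklore] -/
theorem mk_top_mem_hexRegion_iff {x : ℤ} : (![x, 2 * (j : ℤ)] : Site 2) ∈ hexRegion j ↔ 0 ≤ x ∧ x ≤ j := by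
  rw [mem_hexRegion]; simp; omega

/-- Consecutive top-row sites are adjacent. [folklore] -/
theorem adj_top_succ (x : ℤ) : triGraph.Adj (![x, 2 * (j : ℤ)] : Site 2) ![x + 1, 2 * (j : ℤ)] :=
  triGraph_adj_of_eq (Or.inl (by ext i; fin_cases i <;> simp [triE0]))

/-- An axis site is adjacent to its lower-left neighbour `(x₀, 2j)`. [folklore] -/
theorem adj_axis_lower_left {c : Site 2} (hc : c 1 = 2 * j + 1) : triGraph.Adj c ![c 0, 2 * (j : ℤ)] := by
  have : c = (![c 0, 2 * (j : ℤ)] : Site 2) + triE1 := by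
    ext i; fin_cases i <;> simp [triE1]; omega
  conv_lhs => rw [this]
  exact (triGraph_adj_add_triE1 _).symm

/-- An axis site is adjacent to its lower-right neighbour `(x₀ + 1, 2j)`. [folklore] -/
theorem adj_axis_lower_right {c : Site 2} (hc : c 1 = 2 * j + 1) : triGraph.Adj c ![c 0 + 1, 2 * (j : ℤ)] := by
  have : (![c 0 + 1, 2 * (j : ℤ)] : Site 2) = c + triDiag := by
    ext i; fin_cases i <;> simp [LatticeModels.triDiag]; omega
  rw [this]
  exact triGraph_adj_add_triDiag c

/-- The neighbours of an axis site in the row below are its two lower neighbours. [folklore] -/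
theorem eq_lower_of_adj_axis {c b : Site 2} (hc : c 1 = 2 * j + 1) (hb : b 1 = 2 * j) (hcb : triGraph.Adj c b) :
    b = ![c 0, 2 * (j : ℤ)] ∨ b = ![c 0 + 1, 2 * (j : ℤ)] := by
  rw [triGraph_adj_iff_brick] at hcb
  simp only [brickX] at hcb
  have h0 : b 0 = c 0 ∨ b 0 = c 0 + 1 := by omega
  rcases h0 with h0 | h0
  · exact Or.inl (site_eq_mk h0 hb)
  · exact Or.inr (site_eq_mk h0 hb)

/-- The neighbours of an axis site in the row above are the mirror images of its lower
neighbours. [folklore] -/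
theorem rhoB_eq_lower_of_adj_axis {c b : Site 2} (hc : c 1 = 2 * j + 1) (hb : b 1 = 2 * j + 2) (hcb : triGraph.Adj c b) :
    rhoB j b = ![c 0, 2 * (j : ℤ)] ∨ rhoB j b = ![c 0 + 1, 2 * (j : ℤ)] := by
  have hcb' : triGraph.Adj c (rhoB j b) := by
    have := triGraph_adj_rhoB j hcb
    rwa [rhoB_eq_self_of_row j hc] at this
  exact eq_lower_of_adj_axis hc (by simp; omega) hcb'

/-- Axis neighbours of an axis site. [folklore] -/
theorem axis_adj_axis {c a : Site 2} (hc : c 1 = 2 * j + 1) (ha : a 1 = 2 * j + 1) (hca : triGraph.Adj c a) :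
    a 0 = c 0 + 1 ∨ a 0 + 1 = c 0 := by
  rw [triGraph_adj_iff_brick] at hca
  simp only [brickX] at hca
  omega

/-- How a site of `R°` outside `S` can be adjacent to a site of `S`: from the axis row (to one of
its two lower neighbours) or across the right end of `S`. [folklore] -/
theorem adj_hexRegion_from_outside {a b : Site 2} (ha : a ∈ Rcirc j w) (haS : a ∉ hexRegion j)
    (hb : b ∈ hexRegion j) (hab : triGraph.Adj a b) :
    (a 1 = 2 * j + 1 ∧ b 1 = 2 * j) ∨ b ∈ rightEndS j := by
  rw [mem_Rcirc, mem_bigR, mem_pocket, mem_bigR] at ha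
  rw [mem_hexRegion] at haS hb
  rw [mem_rightEndS, mem_hexRegion]
  rw [triGraph_adj_iff_brick] at hab
  simp only [brickX] at hab
  omega

/-- **Exits into the sealed region come from sites adjacent to `F`.** If `a ∈ R° \ Barrier` is
adjacent to a sealed site `b`, then `a` is adjacent to a frozen site. [cite: BollobasRiordan2006, Ch. 3 Lemma 4] -/
theorem adj_Fset_of_adj_Seal {L₀ : Set (Site 2)} {a b : Site 2} (ha : a ∈ Rcirc j w)
    (haB : a ∉ Barrier j w L₀) (hb : b ∈ Seal j L₀) (hab : triGraph.Adj a b) :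
    ∃ m ∈ Fset j L₀, triGraph.Adj a m := by
  by_cases hbF : b ∈ Fset j L₀
  · exact ⟨b, hbF, hab⟩
  exfalso
  have hbS : b ∈ hexRegion j := hb.1
  by_cases haS : a ∈ hexRegion j
  · -- `a ∈ S \ Seal = Reach`, so `b ∈ Reach`
    have haR : a ∈ Reach j L₀ := by
      by_contra h; exact haB (mem_Barrier.2 (Or.inl ⟨haS, h⟩))
    exact hb.2 (mem_Reach_of_adj haR hbS hbF hab)
  rcases adj_hexRegion_from_outside ha haS hbS hab with ⟨ha1, hb1⟩ | hbR
  · -- `a` on the axis, `b` one of its lower neighbours; the other one is not sealed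
    have hnot : ¬ ((![a 0, 2 * (j : ℤ)] : Site 2) ∈ Seal j L₀ ∧ (![a 0 + 1, 2 * (j : ℤ)] : Site 2) ∈ Seal j L₀) :=
      fun h => haB (mem_Barrier.2 (Or.inr (Or.inr ⟨ha, ha1, h.1, h.2⟩)))
    rcases eq_lower_of_adj_axis ha1 hb1 hab with rfl | rfl
    · have hu : (![a 0 + 1, 2 * (j : ℤ)] : Site 2) ∉ Seal j L₀ := fun h => hnot ⟨hb, h⟩
      by_cases huS : (![a 0 + 1, 2 * (j : ℤ)] : Site 2) ∈ hexRegion j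
      · have huR : (![a 0 + 1, 2 * (j : ℤ)] : Site 2) ∈ Reach j L₀ := by
          by_contra h; exact hu ⟨huS, h⟩
        exact hb.2 (mem_Reach_of_adj huR hbS hbF (adj_top_succ (a 0)).symm)
      · -- then `b = (j, 2j)` is on the right end, hence frozen
        rw [mk_top_mem_hexRegion_iff] at huS
        have hbS' := (mk_top_mem_hexRegion_iff (j := j)).1 hbS
        have hb0 : a 0 = j := by omega
        refine hbF (mem_Fset_of_mem_Seal_of_rightEndS hb ((mem_rightEndS j).2 ⟨hbS, Or.inr ?_⟩))
        simp; omega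
    · have hu : (![a 0, 2 * (j : ℤ)] : Site 2) ∉ Seal j L₀ := fun h => hnot ⟨h, hb⟩
      by_cases huS : (![a 0, 2 * (j : ℤ)] : Site 2) ∈ hexRegion j
      · have huR : (![a 0, 2 * (j : ℤ)] : Site 2) ∈ Reach j L₀ := by
          by_contra h; exact hu ⟨huS, h⟩
        exact hb.2 (mem_Reach_of_adj huR hbS hbF (adj_top_succ (a 0)))
      · -- then `a = (-1, 2j+1)` lies in the pocket
        rw [mk_top_mem_hexRegion_iff] at huS
        have hbS' := (mk_top_mem_hexRegion_iff (j := j)).1 hbS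
        rw [mem_Rcirc, mem_bigR, mem_pocket, mem_bigR] at ha
        omega
  · exact hbF (mem_Fset_of_mem_Seal_of_rightEndS hb hbR)

/-- **Exits into the barrier come from sites adjacent to `F` or to `ρF`.** [cite: BollobasRiordan2006, Ch. 3 Lemma 4 ("this path must meet P")] -/
theorem adj_Fset_or_of_adj_Barrier {L₀ : Set (Site 2)} {a b : Site 2} (ha : a ∈ Rcirc j w)
    (haB : a ∉ Barrier j w L₀) (hbB : b ∈ Barrier j w L₀) (hab : triGraph.Adj a b) :
    (∃ m ∈ Fset j L₀, triGraph.Adj a m) ∨ (∃ m ∈ rhoB j '' Fset j L₀, triGraph.Adj a m) := by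
  rcases mem_Barrier.1 hbB with hb | hb | hb
  · exact Or.inl (adj_Fset_of_adj_Seal ha haB hb hab)
  · right
    rw [mem_image_rhoB_iff] at hb
    have ha' : rhoB j a ∈ Rcirc j w := (rhoB_mem_Rcirc_iff j w).2 ha
    have haB' : rhoB j a ∉ Barrier j w L₀ := fun h => haB ((rhoB_mem_Barrier_iff).1 h)
    obtain ⟨m, hm, hadj⟩ := adj_Fset_of_adj_Seal ha' haB' hb (triGraph_adj_rhoB j hab)
    refine ⟨rhoB j m, ⟨m, hm, rfl⟩, ?_⟩
    have := triGraph_adj_rhoB j hadj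
    rwa [rhoB_rhoB] at this
  · -- `b` is a blocked axis site
    obtain ⟨hbR, hb1, hbl, hbr⟩ := hb
    have hrow := row_adj_le hab
    have ha1 : a 1 = 2 * j ∨ a 1 = 2 * j + 1 ∨ a 1 = 2 * j + 2 := by omega
    rcases ha1 with ha1 | ha1 | ha1
    · -- `a` is a lower neighbour of `b`: sealed, contradiction
      exfalso
      rcases eq_lower_of_adj_axis hb1 ha1 hab.symm with h | h
      · exact haB (mem_Barrier.2 (Or.inl (h ▸ hbl)))
      · exact haB (mem_Barrier.2 (Or.inl (h ▸ hbr)))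
    · -- `a` is an axis neighbour of `b`
      have hnot : ¬ ((![a 0, 2 * (j : ℤ)] : Site 2) ∈ Seal j L₀ ∧ (![a 0 + 1, 2 * (j : ℤ)] : Site 2) ∈ Seal j L₀) :=
        fun h => haB (mem_Barrier.2 (Or.inr (Or.inr ⟨ha, ha1, h.1, h.2⟩)))
      left
      rcases axis_adj_axis hb1 ha1 hab.symm with h0 | h0
      · -- `a` to the right of `b`: `(a₀, 2j) = (b₀ + 1, 2j)` is sealed, `(a₀ + 1, 2j)` is not
        have hl : (![a 0, 2 * (j : ℤ)] : Site 2) ∈ Seal j L₀ := by rw [h0]; exact hbr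
        have hu : (![a 0 + 1, 2 * (j : ℤ)] : Site 2) ∉ Seal j L₀ := fun h => hnot ⟨hl, h⟩
        refine ⟨![a 0, 2 * (j : ℤ)], ?_, adj_axis_lower_left ha1⟩
        by_cases huS : (![a 0 + 1, 2 * (j : ℤ)] : Site 2) ∈ hexRegion j
        · have huR : (![a 0 + 1, 2 * (j : ℤ)] : Site 2) ∈ Reach j L₀ := by
            by_contra h; exact hu ⟨huS, h⟩
          exact mem_Fset_of_mem_Seal_of_adj hl huR (adj_top_succ (a 0)).symm
        · rw [mk_top_mem_hexRegion_iff] at huS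
          have hlS := (mk_top_mem_hexRegion_iff (j := j)).1 hl.1
          refine mem_Fset_of_mem_Seal_of_rightEndS hl ((mem_rightEndS j).2 ⟨hl.1, Or.inr ?_⟩)
          simp; omega
      · -- `a` to the left of `b`: `(a₀ + 1, 2j) = (b₀, 2j)` is sealed, `(a₀, 2j)` is not
        have hr : (![a 0 + 1, 2 * (j : ℤ)] : Site 2) ∈ Seal j L₀ := by rw [h0]; exact hbl
        have hu : (![a 0, 2 * (j : ℤ)] : Site 2) ∉ Seal j L₀ := fun h => hnot ⟨h, hr⟩
        refine ⟨![a 0 + 1, 2 * (j : ℤ)], ?_, adj_axis_lower_right ha1⟩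
        by_cases huS : (![a 0, 2 * (j : ℤ)] : Site 2) ∈ hexRegion j
        · have huR : (![a 0, 2 * (j : ℤ)] : Site 2) ∈ Reach j L₀ := by
            by_contra h; exact hu ⟨huS, h⟩
          exact mem_Fset_of_mem_Seal_of_adj hr huR (adj_top_succ (a 0))
        · exfalso
          rw [mk_top_mem_hexRegion_iff] at huS
          have hrS := (mk_top_mem_hexRegion_iff (j := j)).1 hr.1
          rw [mem_Rcirc, mem_bigR, mem_pocket, mem_bigR] at ha
          omega
    · -- `a` is an upper neighbour of `b`: its mirror image is sealed, contradiction
      exfalso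
      rcases rhoB_eq_lower_of_adj_axis hb1 ha1 hab.symm with h | h
      · exact haB (mem_Barrier.2 (Or.inr (Or.inl ((mem_image_rhoB_iff j).2 (h ▸ hbl)))))
      · exact haB (mem_Barrier.2 (Or.inr (Or.inl ((mem_image_rhoB_iff j).2 (h ▸ hbr)))))

/-- The right end of `R` is outside the barrier (for `L₀ ⊆ S`, `w ≥ 3j + 1`). [folklore] -/
theorem not_mem_Barrier_of_mem_bigRight (hw : 3 * j + 1 ≤ w) {L₀ : Set (Site 2)} {r : Site 2}
    (hr : r ∈ bigRight j w) : r ∉ Barrier j w L₀ := by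
  intro h
  rcases mem_Barrier.1 h with h | h | h
  · have h1 := (mem_hexRegion j).1 h.1
    rw [mem_bigRight, mem_bigR] at hr
    omega
  · rw [mem_image_rhoB_iff] at h
    have h1 := (mem_hexRegion j).1 h.1
    rw [← rhoB_mem_bigRight_iff, mem_bigRight, mem_bigR] at hr
    omega
  · obtain ⟨-, hr1, hl, -⟩ := h
    have h1 := (mk_top_mem_hexRegion_iff (j := j)).1 hl.1
    rw [mem_bigRight, mem_bigR] at hr
    omega

/-- The top-left vertex `(0, 2j)` of `S` is frozen. [folklore] -/
theorem topLeft_mem_Fset (L₀ : Set (Site 2)) : (![0, 2 * (j : ℤ)] : Site 2) ∈ Fset j L₀ := by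
  refine mem_Fset.2 (Or.inr (Or.inr ((mem_leftEnd j).2 ⟨?_, Or.inl (by simp)⟩)))
  rw [mem_hexRegion]; simp; omega

/-- **Covering**: for every candidate `L₀ ⊆ S`, `E° ⊆ Y(L₀) ∪ Y'(L₀)`. The open path from the right
end ends in `LE⁺ ⊆ Barrier ∪ {gateway}`; its initial segment up to the first entrance into the
barrier lies in `D`, and by `adj_Fset_or_of_adj_Barrier` its last site is adjacent to `F` or to
`ρF` (the gateway itself is adjacent to the frozen vertex `(0, 2j)`). [cite: BollobasRiordan2006, Ch. 3 Lemma 4 ("this path must meet P; by symmetry …")] -/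
theorem Ecirc_subset_Yev_union (hw : 3 * j + 1 ≤ w) {L₀ : Set (Site 2)} (hL : L₀ ⊆ hexRegion j) :
    Ecirc j w ⊆ Yev j w L₀ ∪ Y'ev j w L₀ := by
  rintro ω ⟨r, hr, l, hl, hpath⟩
  set G : Set (Site 2) := Barrier j w L₀ with hG
  have hrG : r ∉ G := not_mem_Barrier_of_mem_bigRight hw hr
  have hsub : {z : Site 2 | z ∉ G} ∩ (Rcirc j w ∩ ω) ⊆ Dset j w L₀ ∩ ω := by
    rintro z ⟨hzG, hzR, hzω⟩
    exact ⟨mem_Dset.2 ⟨hzR, hzG⟩, hzω⟩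
  have hrT : ∀ {a : Site 2}, PathIn triGraph ({z : Site 2 | z ∉ G} ∩ (Rcirc j w ∩ ω)) r a →
      r ∈ Tset j w L₀ := fun hp => ⟨(hsub hp.left_mem).1, hr⟩
  rcases hpath.exit_or (R := {z : Site 2 | z ∉ G}) hrG with h | ⟨a, b, haG, hbG, hbA, hab, hra⟩
  · -- the path avoids the barrier: it ends at the gateway
    have hlG : l ∉ G := h.right_mem.1
    have hw' : 2 * j ≤ w := by omega
    have hlgw : l = gateway j := by
      rcases (mem_LEplus_iff j).1 hl with ⟨hlS, hl0⟩ | ⟨hlS, hl0⟩ | hlg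
      · exact absurd (mem_Barrier.2 (Or.inl (Fset_subset_Seal hL
          (mem_Fset.2 (Or.inr (Or.inr ((mem_leftEnd j).2 ⟨hlS, hl0⟩))))))) hlG
      · exact absurd (mem_Barrier.2 (Or.inr (Or.inl ((mem_image_rhoB_iff j).2 (Fset_subset_Seal hL
          (mem_Fset.2 (Or.inr (Or.inr ((mem_leftEnd j).2 ⟨hlS, hl0⟩))))))))) hlG
      · exact hlg
    left
    refine ⟨l, ⟨(hsub h.right_mem).1, ![0, 2 * (j : ℤ)], topLeft_mem_Fset L₀, ?_⟩, r, hrT h, (h.mono hsub).symm⟩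
    rw [hlgw]
    convert adj_axis_lower_left (j := j) (c := gateway j) (by simp) using 2
    simp
  · have hbG' : b ∈ G := not_not.1 hbG
    have haR : a ∈ Rcirc j w := hra.right_mem.2.1
    rcases adj_Fset_or_of_adj_Barrier haR haG hbG' hab with ⟨m, hm, ham⟩ | ⟨m, hm, ham⟩
    · left
      exact ⟨a, ⟨(hsub hra.right_mem).1, m, hm, ham⟩, r, hrT hra, (hra.mono hsub).symm⟩
    · right
      exact ⟨a, ⟨(hsub hra.right_mem).1, m, hm, ham⟩, r, hrT hra, (hra.mono hsub).symm⟩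

/-- **`P(Y(L₀)) ≥ P(E°)/2`** for every candidate `L₀ ⊆ S` (covering and symmetry).
[cite: BollobasRiordan2006, Ch. 3 Lemma 4 ("the probability that some such path first meets P at a site of P₁ is at least P(H(R))/2")] -/
theorem half_real_Ecirc_le_real_Yev (p : unitInterval) (hw : 3 * j + 1 ≤ w) {L₀ : Set (Site 2)}
    (hL : L₀ ⊆ hexRegion j) :
    (triSitePercolation p).real (Ecirc j w) / 2 ≤ (triSitePercolation p).real (Yev j w L₀) := by
  have h1 : (triSitePercolation p).real (Ecirc j w) ≤
      (triSitePercolation p).real (Yev j w L₀ ∪ Y'ev j w L₀) :=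
    measureReal_mono (Ecirc_subset_Yev_union hw hL) (measure_ne_top _ _)
  have h2 := measureReal_union_le (μ := triSitePercolation p) (Yev j w L₀) (Y'ev j w L₀)
  rw [real_Y'ev] at h2
  linarith

end Covering

/-! ### Admissibility and the summation over candidate clusters -/

section Summation

variable {j w : ℕ}

/-- **Admissibility** (Hex exclusivity in the small hexagon): if `S` has an open bottom–top
crossing (`s₁ ↔ s₄`), the white cluster of its left end does not reach its right end `s₂ ∪ s₃` —
a closed path of `S` from the left end to the right end, prolonged through the two cut-off corners
of `R(2j, 2j)`, would be a left–right crossing disjoint from the open bottom–top one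
(`tri_hex_excl_para`). [cite: BollobasRiordan2006, Ch. 5 Lemma 7] -/
theorem not_mem_rightEndS_of_mem_Lcl {ω : SiteConfig (Site 2)}
    (hV : ω ∈ hexCross j (hexSide j 0) (hexSide j 3)) {z : Site 2} (hz : z ∈ Lcl j ω) :
    z ∉ rightEndS j := by
  intro hzR
  obtain ⟨a, ⟨haS, ha0⟩, b, ⟨hbS, hb3⟩, hab⟩ := hV
  change a 1 = 0 at ha0
  change b 1 = 2 * j at hb3
  obtain ⟨t, ht, htz⟩ := hz
  set P : Set (Site 2) := para 0 (2 * j) (2 * j) with hPdef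
  have hmemP : ∀ {u : Site 2}, u ∈ P ↔ 0 ≤ u 0 ∧ u 0 ≤ 2 * j ∧ 0 ≤ u 1 ∧ u 1 ≤ 2 * j := by
    intro u; rw [hPdef, mem_para]; simp
  have hSP : hexRegion j ⊆ P := fun u hu => by rw [mem_hexRegion] at hu; rw [hmemP]; omega
  -- the colouring: closed sites of `S` and the two corners
  set B : Set (Site 2) := (hexRegion j ∩ ωᶜ) ∪ {u | u ∈ P ∧ u 0 + u 1 ≤ (j : ℤ) - 1} ∪
    {u | u ∈ P ∧ 3 * (j : ℤ) + 1 ≤ u 0 + u 1} with hBdef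
  have memB : ∀ {u : Site 2}, u ∈ B ↔ (u ∈ hexRegion j ∧ u ∉ ω) ∨ (u ∈ P ∧ u 0 + u 1 ≤ (j : ℤ) - 1) ∨
      (u ∈ P ∧ 3 * (j : ℤ) + 1 ≤ u 0 + u 1) := by
    intro u; simp only [hBdef, Set.mem_union, Set.mem_inter_iff, Set.mem_compl_iff, Set.mem_setOf_eq, or_assoc]
  -- the open bottom–top crossing avoids `B`
  have hTB : PathIn triGraph (P ∩ Bᶜ) a b := by
    refine hab.mono fun u hu => ⟨hSP hu.1, fun huB => ?_⟩
    rcases memB.1 huB with h | h | h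
    · exact h.2 hu.2
    · have := (mem_hexRegion j).1 hu.1; omega
    · have := (mem_hexRegion j).1 hu.1; omega
  -- the closed path, prolonged to the left side
  have htS := (mem_leftEnd j).1 ht
  have htS' := (mem_hexRegion j).1 htS.1
  set nL : ℕ := (t 0).toNat with hnL
  have hnLv : (nL : ℤ) = t 0 := by rw [hnL]; exact Int.toNat_of_nonneg (by omega)
  have hleft : PathIn triGraph (P ∩ B) (t - (nL : ℤ) • triE0) t := by
    refine triPathIn_row_left nL fun i hi => ?_
    have hi' : (i : ℤ) ≤ nL := by exact_mod_cast hi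
    rcases Nat.eq_zero_or_pos i with rfl | hipos
    · simp only [Nat.cast_zero, zero_smul, sub_zero]
      exact ⟨hSP htS.1, memB.2 (Or.inl ⟨htS.1, htz.left_mem.2⟩)⟩
    · have hi1 : (1 : ℤ) ≤ i := by exact_mod_cast hipos
      have ht0 : t 0 + t 1 = j := by
        rcases htS.2 with h | h
        · -- `t` on the side `x₀ = 0`: then `nL = 0`, contradiction with `i ≥ 1`
          exfalso; rw [h] at hnLv; omega
        · exact h
      refine ⟨?_, memB.2 (Or.inr (Or.inl ⟨?_, ?_⟩))⟩
      · rw [hmemP]; simp; omega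
      · rw [hmemP]; simp; omega
      · simp; omega
  have hxcoord : (t - (nL : ℤ) • triE0) 0 = (0 : Site 2) 0 := by simp; omega
  -- … and to the right side
  have hzS := (mem_rightEndS j).1 hzR
  have hzS' := (mem_hexRegion j).1 hzS.1
  set nR : ℕ := (2 * (j : ℤ) - z 0).toNat with hnR
  have hnRv : (nR : ℤ) = 2 * j - z 0 := by rw [hnR]; exact Int.toNat_of_nonneg (by omega)
  have hright : PathIn triGraph (P ∩ B) z (z + (nR : ℤ) • triE0) := by
    refine triPathIn_row_right nR fun i hi => ?_
    have hi' : (i : ℤ) ≤ nR := by exact_mod_cast hi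
    rcases Nat.eq_zero_or_pos i with rfl | hipos
    · simp only [Nat.cast_zero, zero_smul, add_zero]
      exact ⟨hSP hzS.1, memB.2 (Or.inl ⟨hzS.1, htz.right_mem.2⟩)⟩
    · have hi1 : (1 : ℤ) ≤ i := by exact_mod_cast hipos
      have hz0 : z 0 + z 1 = 3 * j := by
        rcases hzS.2 with h | h
        · exfalso; rw [h] at hnRv; omega
        · exact h
      refine ⟨?_, memB.2 (Or.inr (Or.inr ⟨?_, ?_⟩))⟩
      · rw [hmemP]; simp; omega
      · rw [hmemP]; simp; omega
      · simp; omega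
  have hycoord : (z + (nR : ℤ) • triE0) 0 = (0 : Site 2) 0 + 2 * j := by simp; omega
  have hLR : PathIn triGraph (P ∩ B) (t - (nL : ℤ) • triE0) (z + (nR : ℤ) • triE0) :=
    (hleft.trans (htz.mono fun u hu => ⟨hSP hu.1, memB.2 (Or.inl ⟨hu.1, hu.2⟩)⟩)).trans hright
  exact tri_hex_excl_para 0 (2 * j) (2 * j) B hxcoord hycoord hLR (by simp [ha0]) (by simp [hb3]) hTB

open Classical in
/-- The admissible candidate clusters: subsets of `S` not meeting its right end `s₂ ∪ s₃`.
[cite: BollobasRiordan2006, Ch. 3 Lemma 4] -/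
def validFamily (j : ℕ) : Finset (Finset (Site 2)) :=
  (hexFinset j).powerset.filter fun T => ∀ z ∈ T, z ∉ rightEndS j

/-- Membership in `validFamily`. [cite: BollobasRiordan2006, Ch. 3 Lemma 4] -/
theorem mem_validFamily {T : Finset (Site 2)} :
    T ∈ validFamily j ↔ (↑T : Set (Site 2)) ⊆ hexRegion j ∧ ∀ z ∈ T, z ∉ rightEndS j := by
  classical
  rw [validFamily, Finset.mem_filter, Finset.mem_powerset, ← Finset.coe_subset, coe_hexFinset]

/-- **On an open bottom–top crossing of `S`, the left-end white cluster is admissible**: the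
crossing event is covered by the events `{L = L₀}`, `L₀ ∈ validFamily` (Bollobás–Riordan: "the
event `V(S)` is a disjoint union of events of the form `{LV(S) = P₁}`"). [cite: BollobasRiordan2006, Ch. 3 Lemma 4] -/
theorem hexCross_subset_iUnion_Eev :
    hexCross j (hexSide j 0) (hexSide j 3) ⊆ ⋃ T ∈ validFamily j, Eev j (↑T : Set (Site 2)) := by
  classical
  intro ω hω
  let T : Finset (Site 2) := (hexFinset j).filter fun z => z ∈ Lcl j ω
  have hT : (↑T : Set (Site 2)) = Lcl j ω := by
    ext z
    simp only [T, Finset.coe_filter, Set.mem_setOf_eq, ← Finset.mem_coe, coe_hexFinset]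
    exact ⟨fun h => h.2, fun h => ⟨Lcl_subset_hexRegion ω h, h⟩⟩
  refine Set.mem_iUnion₂.2 ⟨T, mem_validFamily.2 ⟨?_, fun z hz => ?_⟩, ?_⟩
  · rw [hT]; exact Lcl_subset_hexRegion ω
  · rw [← Finset.mem_coe, hT] at hz
    exact not_mem_rightEndS_of_mem_Lcl hω hz
  · show Lcl j ω = ↑T
    rw [hT]

/-- **The conditioning step, abstract form.** If an event `A` contains `{L = L₀} ∩ Y(L₀)` for every
admissible `L₀`, then `P(A) ≥ P(E°) · P(s₁ ↔ s₄ in H_j) / 2`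
(`P(A) ≥ Σ_{L₀} P(L = L₀, Y(L₀)) = Σ P(L = L₀) P(Y(L₀)) ≥ ½ P(E°) Σ P(L = L₀) ≥ ½ P(E°) P(V(S))`).
[cite: BollobasRiordan2006, Ch. 3 Lemma 4 (conclusion P(X(R)) ≥ P(H(R)) P(V(S))/2)] -/
theorem real_ge_of_glue (p : unitInterval) (hw : 3 * j + 1 ≤ w) {A : Set (SiteConfig (Site 2))}
    (hglue : ∀ T ∈ validFamily j, Eev j (↑T : Set (Site 2)) ∩ Yev j w ↑T ⊆ A) :
    (triSitePercolation p).real (Ecirc j w) *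
        (triSitePercolation p).real (hexCross j (hexSide j 0) (hexSide j 3)) / 2 ≤
      (triSitePercolation p).real A := by
  set μ := triSitePercolation p with hμ
  set V := validFamily j with hV
  have hVsub : ∀ T ∈ V, (↑T : Set (Site 2)) ⊆ hexRegion j := fun T hT => (mem_validFamily.1 hT).1
  have hdE : Set.PairwiseDisjoint (↑V : Set (Finset (Site 2))) fun T => Eev j (↑T : Set (Site 2)) :=
    fun T _ T' _ hTT' => disjoint_Eev hTT'
  have hdEY : Set.PairwiseDisjoint (↑V : Set (Finset (Site 2)))
      fun T => Eev j (↑T : Set (Site 2)) ∩ Yev j w ↑T :=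
    fun T hT T' hT' hTT' => (hdE hT hT' hTT').mono Set.inter_subset_left Set.inter_subset_left
  have hmE : ∀ T ∈ V, MeasurableSet (Eev j (↑T : Set (Site 2))) := fun T hT => measurableSet_Eev (hVsub T hT)
  have hmEY : ∀ T ∈ V, MeasurableSet (Eev j (↑T : Set (Site 2)) ∩ Yev j w ↑T) := fun T hT =>
    (hmE T hT).inter (measurableSet_Yev T)
  have hE0 : 0 ≤ μ.real (Ecirc j w) := measureReal_nonneg
  have hcov : μ.real (hexCross j (hexSide j 0) (hexSide j 3)) ≤ μ.real (⋃ T ∈ V, Eev j (↑T : Set (Site 2))) :=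
    measureReal_mono (hexCross_subset_iUnion_Eev (j := j)) (measure_ne_top μ _)
  calc μ.real (Ecirc j w) * μ.real (hexCross j (hexSide j 0) (hexSide j 3)) / 2
      ≤ μ.real (Ecirc j w) * μ.real (⋃ T ∈ V, Eev j (↑T : Set (Site 2))) / 2 := by
        have := mul_le_mul_of_nonneg_left hcov hE0
        linarith
    _ = (∑ T ∈ V, μ.real (Eev j (↑T : Set (Site 2)))) * (μ.real (Ecirc j w) / 2) := by
        rw [measureReal_biUnion_finset hdE hmE]; ring
    _ = ∑ T ∈ V, μ.real (Eev j (↑T : Set (Site 2))) * (μ.real (Ecirc j w) / 2) := by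
        rw [Finset.sum_mul]
    _ ≤ ∑ T ∈ V, μ.real (Eev j (↑T : Set (Site 2))) * μ.real (Yev j w ↑T) := by
        gcongr with T hT
        exact half_real_Ecirc_le_real_Yev p hw (hVsub T hT)
    _ = ∑ T ∈ V, μ.real (Eev j (↑T : Set (Site 2)) ∩ Yev j w ↑T) :=
        Finset.sum_congr rfl fun T hT => (real_Eev_inter_Yev p (hVsub T hT)).symm
    _ = μ.real (⋃ T ∈ V, Eev j (↑T : Set (Site 2)) ∩ Yev j w ↑T) := (measureReal_biUnion_finset hdEY hmEY).symm
    _ ≤ μ.real A := by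
        refine measureReal_mono (Set.iUnion₂_subset fun T hT => ?_) (measure_ne_top _ _)
        exact hglue T hT

end Summation

/-! ### The frozen crossing and the gluing `{L = L₀} ∩ Y(L₀) ⊆ X` -/

section Frontier

variable {j w : ℕ}

/-- **Hex exclusivity in the lattice hexagon, for sets**: a set `P ⊆ S` containing a `𝕋`-path from
the bottom side `s₁` to the top side `s₄` of `S` meets every `𝕋`-path of `S` from the left end
`s₅ ∪ s₆` to the right end `s₂ ∪ s₃` (pad the two cut-off corners of `R(2j, 2j)` onto the second
path and apply `tri_hex_excl_para`). [cite: BollobasRiordan2006, Ch. 5 Lemma 7] -/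
theorem hexRegion_excl {P : Set (Site 2)} (hPS : P ⊆ hexRegion j) {a b t e : Site 2}
    (hab : PathIn triGraph P a b) (ha0 : a 1 = 0) (hb3 : b 1 = 2 * j)
    (hte : PathIn triGraph (hexRegion j \ P) t e) (ht : t ∈ leftEnd j) (he : e ∈ rightEndS j) : False := by
  set Pa : Set (Site 2) := para 0 (2 * j) (2 * j) with hPdef
  have hmemP : ∀ {u : Site 2}, u ∈ Pa ↔ 0 ≤ u 0 ∧ u 0 ≤ 2 * j ∧ 0 ≤ u 1 ∧ u 1 ≤ 2 * j := by
    intro u; rw [hPdef, mem_para]; simp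
  have hSP : hexRegion j ⊆ Pa := fun u hu => by rw [mem_hexRegion] at hu; rw [hmemP]; omega
  set B : Set (Site 2) := (hexRegion j \ P) ∪ {u | u ∈ Pa ∧ u 0 + u 1 ≤ (j : ℤ) - 1} ∪
    {u | u ∈ Pa ∧ 3 * (j : ℤ) + 1 ≤ u 0 + u 1} with hBdef
  have memB : ∀ {u : Site 2}, u ∈ B ↔ (u ∈ hexRegion j ∧ u ∉ P) ∨ (u ∈ Pa ∧ u 0 + u 1 ≤ (j : ℤ) - 1) ∨
      (u ∈ Pa ∧ 3 * (j : ℤ) + 1 ≤ u 0 + u 1) := by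
    intro u; simp only [hBdef, Set.mem_union, Set.mem_sdiff, Set.mem_setOf_eq, or_assoc]
  have hTB : PathIn triGraph (Pa ∩ Bᶜ) a b := by
    refine hab.mono fun u hu => ⟨hSP (hPS hu), fun huB => ?_⟩
    rcases memB.1 huB with h | h | h
    · exact h.2 hu
    · have := (mem_hexRegion j).1 (hPS hu); omega
    · have := (mem_hexRegion j).1 (hPS hu); omega
  have htS := (mem_leftEnd j).1 ht
  have htS' := (mem_hexRegion j).1 htS.1
  set nL : ℕ := (t 0).toNat with hnL
  have hnLv : (nL : ℤ) = t 0 := by rw [hnL]; exact Int.toNat_of_nonneg (by omega)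
  have hleft : PathIn triGraph (Pa ∩ B) (t - (nL : ℤ) • triE0) t := by
    refine triPathIn_row_left nL fun i hi => ?_
    have hi' : (i : ℤ) ≤ nL := by exact_mod_cast hi
    rcases Nat.eq_zero_or_pos i with rfl | hipos
    · simp only [Nat.cast_zero, zero_smul, sub_zero]
      exact ⟨hSP htS.1, memB.2 (Or.inl ⟨htS.1, hte.left_mem.2⟩)⟩
    · have hi1 : (1 : ℤ) ≤ i := by exact_mod_cast hipos
      have ht0 : t 0 + t 1 = j := by
        rcases htS.2 with h | h
        · exfalso; rw [h] at hnLv; omega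
        · exact h
      refine ⟨?_, memB.2 (Or.inr (Or.inl ⟨?_, ?_⟩))⟩
      · rw [hmemP]; simp; omega
      · rw [hmemP]; simp; omega
      · simp; omega
  have hxcoord : (t - (nL : ℤ) • triE0) 0 = (0 : Site 2) 0 := by simp; omega
  have heS := (mem_rightEndS j).1 he
  have heS' := (mem_hexRegion j).1 heS.1
  set nR : ℕ := (2 * (j : ℤ) - e 0).toNat with hnR
  have hnRv : (nR : ℤ) = 2 * j - e 0 := by rw [hnR]; exact Int.toNat_of_nonneg (by omega)
  have hright : PathIn triGraph (Pa ∩ B) e (e + (nR : ℤ) • triE0) := by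
    refine triPathIn_row_right nR fun i hi => ?_
    have hi' : (i : ℤ) ≤ nR := by exact_mod_cast hi
    rcases Nat.eq_zero_or_pos i with rfl | hipos
    · simp only [Nat.cast_zero, zero_smul, add_zero]
      exact ⟨hSP heS.1, memB.2 (Or.inl ⟨heS.1, hte.right_mem.2⟩)⟩
    · have hi1 : (1 : ℤ) ≤ i := by exact_mod_cast hipos
      have he0 : e 0 + e 1 = 3 * j := by
        rcases heS.2 with h | h
        · exfalso; rw [h] at hnRv; omega
        · exact h
      refine ⟨?_, memB.2 (Or.inr (Or.inr ⟨?_, ?_⟩))⟩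
      · rw [hmemP]; simp; omega
      · rw [hmemP]; simp; omega
      · simp; omega
  have hycoord : (e + (nR : ℤ) • triE0) 0 = (0 : Site 2) 0 + 2 * j := by simp; omega
  have hLR : PathIn triGraph (Pa ∩ B) (t - (nL : ℤ) • triE0) (e + (nR : ℤ) • triE0) :=
    (hleft.trans (hte.mono fun u hu => ⟨hSP hu.1, memB.2 (Or.inl ⟨hu.1, hu.2⟩)⟩)).trans hright
  exact tri_hex_excl_para 0 (2 * j) (2 * j) B hxcoord hycoord hLR (by simp [ha0]) (by simp [hb3]) hTB

/-- **Hex existence in the lattice hexagon, for sets**: for every set `Q`, either `S ∩ Q` contains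
a `𝕋`-path from the bottom side to the top side of `S`, or `S \ Q` contains one from the left end
to the right end (`tri_hex_para` in `R(2j, 2j)` with the two cut-off corners given to the second
player). [cite: BollobasRiordan2006, Ch. 5 Lemma 7] -/
theorem hexRegion_hex (Q : Set (Site 2)) :
    (∃ a b, a 1 = 0 ∧ b 1 = 2 * (j : ℤ) ∧ PathIn triGraph (hexRegion j ∩ Q) a b) ∨
      (∃ t ∈ leftEnd j, ∃ e ∈ rightEndS j, PathIn triGraph (hexRegion j \ Q) t e) := by
  set Pa : Set (Site 2) := para 0 (2 * j) (2 * j) with hPdef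
  have hmemP : ∀ {u : Site 2}, u ∈ Pa ↔ 0 ≤ u 0 ∧ u 0 ≤ 2 * j ∧ 0 ≤ u 1 ∧ u 1 ≤ 2 * j := by
    intro u; rw [hPdef, mem_para]; simp
  set KO : Set (Site 2) := {u | u ∈ Pa ∧ u 0 + u 1 ≤ (j : ℤ) - 1} with hKO
  set KC : Set (Site 2) := {u | u ∈ Pa ∧ 3 * (j : ℤ) + 1 ≤ u 0 + u 1} with hKC
  set B : Set (Site 2) := (hexRegion j \ Q) ∪ KO ∪ KC with hBdef
  have memB : ∀ {u : Site 2}, u ∈ B ↔ (u ∈ hexRegion j ∧ u ∉ Q) ∨ (u ∈ Pa ∧ u 0 + u 1 ≤ (j : ℤ) - 1) ∨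
      (u ∈ Pa ∧ 3 * (j : ℤ) + 1 ≤ u 0 + u 1) := by
    intro u; simp only [hBdef, hKO, hKC, Set.mem_union, Set.mem_sdiff, Set.mem_setOf_eq, or_assoc]
  -- a site of `Pa` outside both corners is in `S`
  have hS_of : ∀ {u : Site 2}, u ∈ Pa → ¬ (u 0 + u 1 ≤ (j : ℤ) - 1) → ¬ (3 * (j : ℤ) + 1 ≤ u 0 + u 1) →
      u ∈ hexRegion j := by
    intro u hu h1 h2; rw [hmemP] at hu; rw [mem_hexRegion]; omega
  rcases tri_hex_para 0 (2 * j) (2 * j) B with ⟨x, y, hx, hy, hxy⟩ | ⟨x, y, hx, hy, hxy⟩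
  · -- a `B`-path from the left to the right side: trim the corners
    right
    simp only [Pi.zero_apply, zero_add] at hx hy
    have hyKO : y ∉ KO := by
      rintro ⟨hyP, hys⟩; rw [hmemP] at hyP; omega
    -- last exit from the lower-left corner
    obtain ⟨u, hu, hpath⟩ : ∃ u ∈ leftEnd j, PathIn triGraph ((Pa ∩ B) \ KO) u y := by
      rcases hxy.after_last_exit (C := KO) hyKO with h | ⟨a', b', ha', -, hb'KO, hab', hp⟩
      · refine ⟨x, ?_, h⟩
        have hxB := h.left_mem
        have hxP : x ∈ Pa := hxB.1.1
        have hx1 : ¬ (x 0 + x 1 ≤ (j : ℤ) - 1) := fun h' => hxB.2 ⟨hxP, h'⟩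
        have hx2 : ¬ (3 * (j : ℤ) + 1 ≤ x 0 + x 1) := by rw [hmemP] at hxP; omega
        exact (mem_leftEnd j).2 ⟨hS_of hxP hx1 hx2, Or.inl hx⟩
      · refine ⟨b', ?_, hp⟩
        have hbB := hp.left_mem
        have hbP : b' ∈ Pa := hbB.1.1
        have hb1 : ¬ (b' 0 + b' 1 ≤ (j : ℤ) - 1) := fun h' => hbB.2 ⟨hbP, h'⟩
        have hsum := triGraph_adj_brick hab'
        have hrow := row_adj_le hab'
        simp only [brickX] at hsum
        obtain ⟨-, ha's⟩ := ha'
        have hb2 : ¬ (3 * (j : ℤ) + 1 ≤ b' 0 + b' 1) := by omega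
        refine (mem_leftEnd j).2 ⟨hS_of hbP hb1 hb2, Or.inr ?_⟩
        have := (mem_hexRegion j).1 (hS_of hbP hb1 hb2)
        omega
    have huKC : u ∈ ({z | z ∉ KC} : Set (Site 2)) := by
      rintro ⟨-, hus⟩
      have := (mem_hexRegion j).1 (leftEnd_subset_hexRegion hu); omega
    have hsub : {z : Site 2 | z ∉ KC} ∩ ((Pa ∩ B) \ KO) ⊆ hexRegion j \ Q := by
      rintro z ⟨hzKC, ⟨hzP, hzB⟩, hzKO⟩
      rcases memB.1 hzB with h | h | h
      · exact h
      · exact absurd h hzKO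
      · exact absurd h hzKC
    rcases hpath.exit_or (R := {z : Site 2 | z ∉ KC}) huKC with h | ⟨a', b', ha'KC, hb'KC, -, hab', hp⟩
    · refine ⟨u, hu, y, ?_, h.mono hsub⟩
      have hyS := (hsub h.right_mem).1
      exact (mem_rightEndS j).2 ⟨hyS, Or.inl hy⟩
    · refine ⟨u, hu, a', ?_, hp.mono hsub⟩
      have haS := (hsub hp.right_mem).1
      have hb' : b' ∈ KC := not_not.1 hb'KC
      obtain ⟨-, hbs⟩ := hb'
      have hsum := triGraph_adj_brick hab'
      have hrow := row_adj_le hab'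
      simp only [brickX] at hsum
      have haS' := (mem_hexRegion j).1 haS
      refine (mem_rightEndS j).2 ⟨haS, Or.inr ?_⟩
      omega
  · -- a `Bᶜ`-path from the bottom to the top: it lies in `S ∩ Q`
    left
    simp only [Pi.zero_apply, zero_add] at hx hy
    refine ⟨x, y, hx, hy, hxy.mono fun u hu => ?_⟩
    have huP : u ∈ Pa := hu.1
    have huB : u ∉ B := hu.2
    have h1 : ¬ (u 0 + u 1 ≤ (j : ℤ) - 1) := fun h => huB (memB.2 (Or.inr (Or.inl ⟨huP, h⟩)))
    have h2 : ¬ (3 * (j : ℤ) + 1 ≤ u 0 + u 1) := fun h => huB (memB.2 (Or.inr (Or.inr ⟨huP, h⟩)))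
    have huS := hS_of huP h1 h2
    exact ⟨huS, by_contra fun h => huB (memB.2 (Or.inl ⟨huS, h⟩))⟩

/-- **The frozen crossing** (Bollobás–Riordan's left-most vertical crossing `P₁`, combinatorial
form): if `L₀ ⊆ S` misses the right end of `S`, then `F(L₀) \ L₀` contains a `𝕋`-path inside `S`
from the bottom side to the top side of `S` — a path of `S` from the left end to the right end
avoiding `F \ L₀` would have to leave `L₀` through a site of `∂_S L₀ ⊆ F \ L₀`. On `{L = L₀}` this
crossing is open (`black_of_mem_Fset`). [cite: BollobasRiordan2006, Ch. 3 Lemma 4 (LV(S))] -/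
theorem exists_frozen_crossing {L₀ : Set (Site 2)} (hadm : ∀ z ∈ L₀, z ∉ rightEndS j) :
    ∃ a b, a 1 = 0 ∧ b 1 = 2 * (j : ℤ) ∧ PathIn triGraph (hexRegion j ∩ (Fset j L₀ \ L₀)) a b := by
  rcases hexRegion_hex (j := j) (Fset j L₀ \ L₀) with h | ⟨t, ht, e, he, hte⟩
  · exact h
  exfalso
  have htL : t ∈ L₀ := by
    have h := hte.left_mem
    by_contra htL
    exact h.2 ⟨mem_Fset.2 (Or.inr (Or.inr ht)), htL⟩
  have heL : e ∉ L₀ := fun h => hadm e h he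
  obtain ⟨a', b', ha'L, -, hb'L, hab', hp⟩ := hte.last_exit (C := L₀) htL heL
  have hb' := hp.left_mem
  exact hb'.1.2 ⟨mem_Fset.2 (Or.inr (Or.inl ⟨hb'.1.1, a', ha'L, hab'.symm⟩)), hb'L⟩

/-- **Frontier lemma**: on `{L = L₀}`, a frozen site which is adjacent to the unexplored region
`Reach(L₀)`, or lies on the right end of `S`, belongs to every subset `P ⊆ F(L₀) \ L₀` carrying a
bottom–top crossing of `S`. (Otherwise the unexplored path to it, continued through `L₀` to the
left end, would be a left–right path of `S` avoiding `P`, against `hexRegion_excl`.) This is the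
accessibility of the left-most crossing from the right. [cite: BollobasRiordan2006, Ch. 3 Lemma 4] -/
theorem mem_of_frozen_crossing {ω : SiteConfig (Site 2)} {L₀ P : Set (Site 2)} (hE : ω ∈ Eev j L₀)
    (hL : L₀ ⊆ hexRegion j) (hPF : P ⊆ Fset j L₀) (hPL : Disjoint P L₀) {a b : Site 2} (ha0 : a 1 = 0)
    (hb3 : b 1 = 2 * j) (hab : PathIn triGraph P a b) {m : Site 2} (hm : m ∈ Fset j L₀)
    (hacc : (∃ r ∈ Reach j L₀, triGraph.Adj m r) ∨ m ∈ rightEndS j) : m ∈ P := by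
  by_contra hmP
  have hPS : P ⊆ hexRegion j := fun z hz => Fset_subset_hexRegion hL (hPF hz)
  have hmS : m ∈ hexRegion j := Fset_subset_hexRegion hL hm
  -- an `(S \ P)`-path from the right end to `m`
  obtain ⟨e, he, hem⟩ : ∃ e ∈ rightEndS j, PathIn triGraph (hexRegion j \ P) e m := by
    rcases hacc with ⟨r, ⟨e, he, -, π⟩, hmr⟩ | hmR
    · have π' : PathIn triGraph (hexRegion j \ P) e r := π.mono fun z hz => ⟨hz.1, fun h => hz.2 (hPF h)⟩
      have hm' : m ∈ hexRegion j \ P := ⟨hmS, hmP⟩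
      exact ⟨e, he, π'.tail hmr.symm hm'⟩
    · have hm' : m ∈ hexRegion j \ P := ⟨hmS, hmP⟩
      exact ⟨m, hmR, PathIn.refl hm'⟩
  -- an `(S \ P)`-path from `m` to the left end, through `L₀`
  have hE' : Lcl j ω = L₀ := hE
  have hfromL : ∀ {ℓ : Site 2}, ℓ ∈ L₀ → ∃ t ∈ leftEnd j, PathIn triGraph (hexRegion j \ P) ℓ t := by
    intro ℓ hℓ
    have hℓ' : ℓ ∈ Lcl j ω := by rw [hE']; exact hℓ
    obtain ⟨t, ht, hp⟩ := exists_pathIn_Lcl hℓ'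
    rw [hE'] at hp
    have hp' : PathIn triGraph (hexRegion j \ P) t ℓ :=
      hp.mono fun z hz => ⟨hL hz, fun h => Set.disjoint_left.1 hPL h hz⟩
    exact ⟨t, ht, hp'.symm⟩
  obtain ⟨t, ht, hmt⟩ : ∃ t ∈ leftEnd j, PathIn triGraph (hexRegion j \ P) m t := by
    have hm' : m ∈ hexRegion j \ P := ⟨hmS, hmP⟩
    rcases mem_Fset.1 hm with hmL | ⟨-, ℓ, hℓ, hmℓ⟩ | hmE
    · exact hfromL hmL
    · obtain ⟨t, ht, hp⟩ := hfromL hℓ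
      have hℓP : ℓ ∈ hexRegion j \ P := ⟨hL hℓ, fun h => Set.disjoint_left.1 hPL h hℓ⟩
      exact ⟨t, ht, (PathIn.of_adj hm' hℓP hmℓ).trans hp⟩
    · exact ⟨m, hmE, PathIn.refl hm'⟩
  exact hexRegion_excl hPS hab ha0 hb3 (hem.trans hmt).symm ht he

/-- **Bollobás–Riordan's event `X(R)`** for the hexagon: a site `c` of `S` joined inside `S` by
open paths to the bottom side and to the top side of `S` (so that `c` lies on an open bottom–top
crossing of `S`), and joined inside `R°` by an open path to the right end of `R`. An increasing
event not mentioning `L₀`. [cite: BollobasRiordan2006, Ch. 3 Lemma 4 (X(R))] -/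
def Xev (j w : ℕ) : Set (SiteConfig (Site 2)) :=
  {ω | ∃ c, (∃ a ∈ hexSide j 0, PathIn triGraph (hexRegion j ∩ ω) c a) ∧
    (∃ b ∈ hexSide j 3, PathIn triGraph (hexRegion j ∩ ω) c b) ∧
      ∃ r ∈ bigRight j w, PathIn triGraph (Rcirc j w ∩ ω) c r}

/-- `X(R)` is increasing. [folklore] -/
theorem isUpperSet_Xev : IsUpperSet (Xev j w) := by
  rintro ω ω' hle ⟨c, ⟨a, ha, hca⟩, ⟨b, hb, hcb⟩, r, hr, hcr⟩
  exact ⟨c, ⟨a, ha, hca.mono (Set.inter_subset_inter_right _ hle)⟩,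
    ⟨b, hb, hcb.mono (Set.inter_subset_inter_right _ hle)⟩, r, hr, hcr.mono (Set.inter_subset_inter_right _ hle)⟩

/-- On `{L = L₀} ∩ Y(L₀)`, the frozen site at which `Y`'s path starts is accessible: adjacent to
the unexplored region, or on the right end of `S`. [cite: BollobasRiordan2006, Ch. 3 Lemma 4] -/
theorem acc_of_mem_Aset {L₀ : Set (Site 2)} (hL : L₀ ⊆ hexRegion j) {x m : Site 2} (hx : x ∈ Dset j w L₀)
    (hm : m ∈ Fset j L₀) (hxm : triGraph.Adj x m) :
    (∃ r ∈ Reach j L₀, triGraph.Adj m r) ∨ m ∈ rightEndS j := by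
  have hmS : m ∈ hexRegion j := Fset_subset_hexRegion hL hm
  have hxR : x ∈ Rcirc j w := Dset_subset_Rcirc hx
  have hxB : x ∉ Barrier j w L₀ := (mem_Dset.1 hx).2
  by_cases hxS : x ∈ hexRegion j
  · exact Or.inl ⟨x, mem_Reach_of_mem_Dset hx hxS, hxm.symm⟩
  rcases adj_hexRegion_from_outside hxR hxS hmS hxm with ⟨hx1, hm1⟩ | hmR
  · have hmSeal : m ∈ Seal j L₀ := Fset_subset_Seal hL hm
    have hnot : ¬ ((![x 0, 2 * (j : ℤ)] : Site 2) ∈ Seal j L₀ ∧ (![x 0 + 1, 2 * (j : ℤ)] : Site 2) ∈ Seal j L₀) :=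
      fun h => hxB (mem_Barrier.2 (Or.inr (Or.inr ⟨hxR, hx1, h.1, h.2⟩)))
    rcases eq_lower_of_adj_axis hx1 hm1 hxm with hmeq | hmeq
    · have hu : (![x 0 + 1, 2 * (j : ℤ)] : Site 2) ∉ Seal j L₀ := fun h => hnot ⟨hmeq ▸ hmSeal, h⟩
      by_cases huS : (![x 0 + 1, 2 * (j : ℤ)] : Site 2) ∈ hexRegion j
      · have huR : (![x 0 + 1, 2 * (j : ℤ)] : Site 2) ∈ Reach j L₀ := by
          by_contra h; exact hu ⟨huS, h⟩
        refine Or.inl ⟨_, huR, ?_⟩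
        rw [hmeq]; exact adj_top_succ (x 0)
      · right
        rw [mk_top_mem_hexRegion_iff] at huS
        have hmS' := (mk_top_mem_hexRegion_iff (j := j)).1 (hmeq ▸ hmS)
        refine (mem_rightEndS j).2 ⟨hmS, Or.inr ?_⟩
        rw [hmeq]; simp; omega
    · have hu : (![x 0, 2 * (j : ℤ)] : Site 2) ∉ Seal j L₀ := fun h => hnot ⟨h, hmeq ▸ hmSeal⟩
      by_cases huS : (![x 0, 2 * (j : ℤ)] : Site 2) ∈ hexRegion j
      · have huR : (![x 0, 2 * (j : ℤ)] : Site 2) ∈ Reach j L₀ := by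
          by_contra h; exact hu ⟨huS, h⟩
        refine Or.inl ⟨_, huR, ?_⟩
        rw [hmeq]; exact (adj_top_succ (x 0)).symm
      · exfalso
        rw [mk_top_mem_hexRegion_iff] at huS
        have hmS' := (mk_top_mem_hexRegion_iff (j := j)).1 (hmeq ▸ hmS)
        rw [mem_Rcirc, mem_bigR, mem_pocket, mem_bigR] at hxR
        omega
  · exact Or.inr hmR

/-- **Gluing** (Bollobás–Riordan: "if `Y(P₁)` holds [and `LV(S) = P₁`], then so does `X(R)`"): on
`{L = L₀} ∩ Y(L₀)` with `L₀` admissible, the frozen site `m` at which `Y`'s open path starts lies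
on the frozen open bottom–top crossing of `S` (`exists_frozen_crossing`, `mem_of_frozen_crossing`)
and is joined to the right end of `R`, so `X(R)` holds with `c = m`. [cite: BollobasRiordan2006, Ch. 3 Lemma 4] -/
theorem Eev_inter_Yev_subset_Xev (hw : 2 * j ≤ w) {T : Finset (Site 2)} (hT : T ∈ validFamily j) :
    Eev j (↑T : Set (Site 2)) ∩ Yev j w ↑T ⊆ Xev j w := by
  rintro ω ⟨hE, x, ⟨hxD, m, hmF, hxm⟩, y, ⟨hyD, hyR⟩, hβ⟩
  obtain ⟨hL, hadm⟩ := mem_validFamily.1 hT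
  set L₀ : Set (Site 2) := ↑T with hL₀
  have hadm' : ∀ z ∈ L₀, z ∉ rightEndS j := fun z hz => hadm z hz
  -- the frozen crossing and its two "halves" through reachability
  obtain ⟨a, b, ha0, hb3, hab⟩ := exists_frozen_crossing hadm'
  set P₀ : Set (Site 2) := hexRegion j ∩ (Fset j L₀ \ L₀) with hP₀
  have hP₀ω : P₀ ⊆ hexRegion j ∩ ω := fun z hz => ⟨hz.1, black_of_mem_Fset hE hz.2.1 hz.2.2⟩
  have hacc := acc_of_mem_Aset hL hxD hmF hxm
  -- `m` is on the part of the crossing reachable from `a` …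
  have hma : PathIn triGraph P₀ a m := by
    set Pa : Set (Site 2) := {z | PathIn triGraph P₀ a z} with hPa
    have habPa : PathIn triGraph Pa a b :=
      (hab.inter_of_forall (C := Pa) fun u hu => hu).mono Set.inter_subset_right
    have hPaF : Pa ⊆ Fset j L₀ := fun z hz => (PathIn.right_mem hz).2.1
    have hPaL : Disjoint Pa L₀ := Set.disjoint_left.2 fun z hz hzL => (PathIn.right_mem hz).2.2 hzL
    exact mem_of_frozen_crossing hE hL hPaF hPaL ha0 hb3 habPa hmF hacc
  -- … and on the part from which `b` is reachable
  have hmb : PathIn triGraph P₀ m b := by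
    set Pb : Set (Site 2) := {z | PathIn triGraph P₀ z b} with hPb
    have habPb : PathIn triGraph Pb a b := by
      have h := (hab.symm.inter_of_forall (C := Pb) fun u hu => hu.symm).mono Set.inter_subset_right
      exact h.symm
    have hPbF : Pb ⊆ Fset j L₀ := fun z hz => (PathIn.left_mem hz).2.1
    have hPbL : Disjoint Pb L₀ := Set.disjoint_left.2 fun z hz hzL => (PathIn.left_mem hz).2.2 hzL
    exact mem_of_frozen_crossing hE hL hPbF hPbL ha0 hb3 habPb hmF hacc
  have hmP₀ : m ∈ P₀ := hma.right_mem
  refine ⟨m, ⟨a, ⟨hab.left_mem.1, ha0⟩, (hma.mono hP₀ω).symm⟩, ⟨b, ⟨hab.right_mem.1, hb3⟩, hmb.mono hP₀ω⟩,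
    y, hyR, ?_⟩
  -- `m → x → (Y's path) → y` inside `R° ∩ ω`
  have hmRω : m ∈ Rcirc j w ∩ ω := ⟨hexRegion_subset_Rcirc j w hw hmP₀.1, (hP₀ω hmP₀).2⟩
  have hxRω : x ∈ Rcirc j w ∩ ω := ⟨Dset_subset_Rcirc hxD, hβ.left_mem.2⟩
  exact (PathIn.of_adj hmRω hxRω hxm.symm).trans (hβ.mono fun z hz => ⟨Dset_subset_Rcirc hz.1, hz.2⟩)

/-- **Bollobás–Riordan's Lemma 4 for the lattice hexagon of `𝕋`, at every density `p`:**
`P_p(X(R)) ≥ P_p(E°) · P_p(s₁ ↔ s₄ in H_j) / 2` for `j ≥ 1`, `w ≥ 3j + 1`, where `X(R)` (`Xev`) is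
"an open bottom–top crossing of the small hexagon `S = H_j` joined inside `R°` to the right end of
the elongated hexagon `R`", `E°` (`Ecirc`) is "an open path in `R°` from the right end of `R` to
the left ends of `S`, `ρS`", and `s₁ ↔ s₄ in H_j` is the bottom–top crossing of `S`
(`hexCross j (hexSide j 0) (hexSide j 3)`, controlled by rhombus crossings in
`TriHexagon.hexOpposite_prob_ge`). [cite: BollobasRiordan2006, Ch. 3 Lemma 4] -/
theorem xev_prob_ge (p : unitInterval) (hw : 3 * j + 1 ≤ w) :
    (triSitePercolation p).real (Ecirc j w) *
        (triSitePercolation p).real (hexCross j (hexSide j 0) (hexSide j 3)) / 2 ≤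
      (triSitePercolation p).real (Xev j w) :=
  real_ge_of_glue p hw fun _ hT => Eev_inter_Yev_subset_Xev (by omega) hT

end Frontier

end TriHexagon

end Literature.Probability.Percolation
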